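import Literature.Topology.FourManifolds.BandCoreLoop
import Literature.Topology.FourManifolds.BandFrames
import Literature.Topology.FourManifolds.PreBandData
import Literature.Topology.FourManifolds.BandThickening
import Mathlib.Analysis.SpecialFunctions.Trigonometric.ArctanDeriv
import HarnessLib

/-!
# A band from an embedded core arc: thickening, blending, normalising

Topic `Literature/Topology/FourManifolds` (trunk T-4MAN). Fact seat
`provefact-Literature.Topology.FourManifolds.Knot.exists_isBandSum` (`BandSum.lean`: existence of
band sums, R. E. Gompf, A. I. Stipsicz, *4-Manifolds and Kirby Calculus* (1999), §5.1).  From the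
output of `exists_coreLoop` (`BandCoreLoop.lean`: tubular neighbourhoods `ν₁`, `ν₂` of the two
disjoint knots, a radius `r`, a margin `h`, and a knot `e` which near the angle `0` is the radial
segment of `ν₁` through `K₁ (1, 0)`, near the angle `π` the radial segment of `ν₂` through
`K₂ (1, 0)`, and otherwise runs off `avoid ∪ K₁ ∪ K₂`) this file builds **pre-band data**
`PreBandData K₁ K₂ avoid` (`PreBandData.lean`): a band from `K₁` to `K₂` avoiding `avoid`.

## Construction (Gompf–Stipsicz (1999), §5.1; Hirsch (1976), Ch. 4 §5)

Coordinates `(x₀, s)`: `x₀` along the core (`core x₀ = e (circlePoint (π x₀))`, from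
`K₁ (1, 0)` at `x₀ = 0` to `K₂ (1, 0)` at `x₀ = 1`), `s` across.  Three `ℝ⁴`-valued strips:

* the **left strip** `P₁ (x₀, s) = ν₁ (circlePoint s, (rπx₀/2) e₀)` — the flat strip of the
  product structure of `ν₁` containing the arc `s ↦ K₁ (circlePoint s)` as its line `x₀ = 0`,
  traversed upwards;
* the **right strip** `P₂ (x₀, s) = ν₂ (circlePoint (-s), (rπ(x₀ - 1)/2) e₀)` — containing
  `K₂` as its line `x₀ = 1`, traversed downwards;
* the **middle strip** `M (x₀, s) = core x₀ + s N (x₀)`, the ruled strip along a normal field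
  `N x₀ = ∂_w ν_e (circlePoint (πx₀), 0) · w x₀` read off a tubular neighbourhood `ν_e` of the
  core knot `e`, where the planar field `w` is **solved by Cramer's rule** in the frame
  `(core, ∂_θ ν_e, ∂_{w₁} ν_e, ∂_{w₂} ν_e)` (positive determinant, `TubularNbhd.det_pos`) so that
  on the two blending zones `N` agrees with `∂_s P₁`, resp. `∂_s P₂`, modulo the tangent plane
  `span (core, core')`, and interpolated without zeros in between
  (`exists_contDiff_interpolate_ne_zero`).

They are blended with cut-offs in `x₀` — `A = χ₁ P₁ + χ₂ P₂ + (1 - χ₁ - χ₂) M` — and normalised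
to `S³`.  Along the core `A = core` and `∂_s A ∉ span (core, core')`, so `A/‖A‖` is an immersion
near the core (`injective_fderiv_normalize`), injective on a uniform thin strip
(`exists_nhds_injOn_of_injective_fderiv`, `exists_injOn_prod_ball_of_isCompact`), off
`avoid ∪ K₁ ∪ K₂` over the middle of the core; near the ends it *is* the flat strip of `ν₁`
(resp. `ν₂`), which meets `K₁` exactly in the line `x₀ = 0` (resp. `K₂` in `x₀ = 1`) and lies in
the tube missing `avoid` and the other knot.  The collar coordinate `x₁` of `BandData` enters
through `s = η arctan (x₁ - 1/2)`.

Everything here is proved; the file introduces the hypothesis structure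
`Literature.Topology.FourManifolds.CoreData` (the output of `exists_coreLoop` plus a tubular
neighbourhood of the core knot) and definitions of the auxiliary maps, and ends with
`CoreData.nonempty_preBandData` and `Knot.exists_preBandData`.  No named facts are introduced.

## References

* R. E. Gompf, A. I. Stipsicz, *4-Manifolds and Kirby Calculus*, GSM 20, AMS (1999), §5.1
  (band sums; Fig. 5.7). [GompfStipsicz1999]
* M. W. Hirsch, *Differential Topology*, GTM 33 (1976), Ch. 4 §5 (tubular neighbourhoods),
  Ch. 2 §1 (local form of immersions). [HirschDT1976]
* P. R. Cromwell, *Knots and Links* (2004), §4.6 (the rectangle of the product of knots).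
  [Cromwell2004]
-/

open scoped Manifold ContDiff Topology Real
open Function Set Filter Metric

noncomputable section

namespace Literature.Topology.FourManifolds

/-- Local notation: `𝔼 n` is the model Euclidean space `EuclideanSpace ℝ (Fin n)`. -/
local notation "𝔼 " n:arg => EuclideanSpace ℝ (Fin n)

/-- Local notation: `𝕊 n` is the unit sphere in `EuclideanSpace ℝ (Fin (n + 1))`. -/
local notation "𝕊 " n:arg => (Metric.sphere (0 : EuclideanSpace ℝ (Fin (n + 1))) 1)

/-! ### The data of a core loop -/

/-- **Core data** for a band from `K₁` to `K₂` avoiding `avoid`: the output of `exists_coreLoop`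
(`BandCoreLoop.lean`) together with a tubular neighbourhood `νe` of the core knot `e`.
Tubular neighbourhoods `ν₁`, `ν₂` of the two knots; a radius `r` such that the closed tubes of
radius `r` miss `avoid`, the other knot and each other; a margin `0 < h ≤ 1/16`; a knot `e` equal
to the radial segment `θ ↦ ν₁ ((1, 0), (rθ/2) e₀)` for `|θ| ≤ h` and to
`θ ↦ ν₂ ((1, 0), (r(θ - π)/2) e₀)` for `|θ - π| ≤ h`, missing `avoid`, meeting `K₁` only at the
angle `0` and `K₂` only at the angle `π`. [folklore] -/
structure CoreData (K₁ K₂ : Knot) (avoid : Set (𝕊 3)) where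
  /-- Tubular neighbourhood of `K₁`. -/
  ν₁ : Knot.TubularNbhd K₁
  /-- Tubular neighbourhood of `K₂`. -/
  ν₂ : Knot.TubularNbhd K₂
  /-- The tube radius. -/
  r : ℝ
  /-- The angular margin of the two germs. -/
  h : ℝ
  /-- The core knot. -/
  e : Knot
  /-- Tubular neighbourhood of the core knot. -/
  νe : Knot.TubularNbhd e
  /-- The radius is positive. -/
  r_pos : 0 < r
  /-- The margin is positive. -/
  h_pos : 0 < h
  /-- The margin is at most `1/16`. -/
  h_le : h ≤ 1 / 16
  /-- The closed tube about `K₁` misses `avoid` and `K₂`. -/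
  tube₁ : ∀ (x : 𝕊 1) (w : 𝔼 2), ‖w‖ ≤ r → ν₁ (x, w) ∉ avoid ∧ ν₁ (x, w) ∉ range K₂
  /-- The closed tube about `K₂` misses `avoid` and `K₁`. -/
  tube₂ : ∀ (x : 𝕊 1) (w : 𝔼 2), ‖w‖ ≤ r → ν₂ (x, w) ∉ avoid ∧ ν₂ (x, w) ∉ range K₁
  /-- The two closed tubes are disjoint. -/
  tube₁₂ : ∀ (x x' : 𝕊 1) (w w' : 𝔼 2), ‖w‖ ≤ r → ‖w'‖ ≤ r → ν₁ (x, w) ≠ ν₂ (x', w')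
  /-- The germ of `e` at `K₁`: a radial segment of `ν₁`. -/
  germ₁ : ∀ θ : ℝ, |θ| ≤ h →
    e (circlePoint θ) = ν₁ (circlePoint 0, (r / 2 * θ) • (EuclideanSpace.single 0 1 : 𝔼 2))
  /-- The germ of `e` at `K₂`: a radial segment of `ν₂`. -/
  germ₂ : ∀ θ : ℝ, |θ - π| ≤ h →
    e (circlePoint θ) = ν₂ (circlePoint 0, (r / 2 * (θ - π)) • (EuclideanSpace.single 0 1 : 𝔼 2))
  /-- The core knot misses `avoid`. -/
  e_not_mem : ∀ u, e u ∉ avoid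
  /-- The core knot meets `K₁` only at the angle `0`. -/
  e_mem_left : ∀ u, e u ∈ range K₁ → u = circlePoint 0
  /-- The core knot meets `K₂` only at the angle `π`. -/
  e_mem_right : ∀ u, e u ∈ range K₂ → u = circlePoint π
  /-- The set to avoid is closed. -/
  isClosed_avoid : IsClosed avoid

attribute [local instance] fact_finrank_euclideanSpace_two fact_finrank_euclideanSpace_four

namespace CoreData

variable {K₁ K₂ : Knot} {avoid : Set (𝕊 3)} (D : CoreData K₁ K₂ avoid)

/-! ### Constants -/

/-- Half the tube radius: the speed of the radial segments. [folklore] -/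
def κ : ℝ := D.r / 2

/-- The half-width `ζ = h/π` of the two germ zones in the coordinate `x₀` (`θ = π x₀`).
[folklore] -/
def ζ : ℝ := D.h / π

/-- The collar width `a = ζ/4`; the blending zones are `[a, 2a]` and `[1 - 2a, 1 - a]`.
[folklore] -/
def a : ℝ := D.ζ / 4

/-- `κ > 0`. [folklore] -/
theorem κ_pos : 0 < D.κ := by unfold κ; linarith [D.r_pos]

/-- `ζ > 0`. [folklore] -/
theorem ζ_pos : 0 < D.ζ := by unfold ζ; exact div_pos D.h_pos Real.pi_pos

/-- `a > 0`. [folklore] -/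
theorem a_pos : 0 < D.a := by unfold a; linarith [D.ζ_pos]

/-- `π ζ = h`. [folklore] -/
theorem pi_mul_ζ : π * D.ζ = D.h := by unfold ζ; field_simp

/-- `ζ ≤ 1/16`. [folklore] -/
theorem ζ_le : D.ζ ≤ 1 / 16 := by
  unfold ζ
  rw [div_le_iff₀ Real.pi_pos]
  have := D.h_le
  nlinarith [Real.pi_gt_three]

/-- `4a = ζ`. [folklore] -/
theorem four_mul_a : 4 * D.a = D.ζ := by unfold a; ring

/-- `a ≤ 1/64`. [folklore] -/
theorem a_le : D.a ≤ 1 / 64 := by have := D.ζ_le; unfold a; linarith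

/-- The first basis vector of the fibre. [folklore] -/
theorem single_ne_zero : (EuclideanSpace.single 0 1 : 𝔼 2) ≠ 0 :=
  Knot.TubularNbhd.single_zero_one_ne_zero

/-! ### The core curve and its two end descriptions -/

/-- The **core curve** in `ℝ⁴`: `core x₀ = e (circlePoint (π x₀))`, read through the tubular
neighbourhood of `e` (`νe (circlePoint (π x₀), 0)`). [folklore] -/
def core (x : ℝ) : 𝔼 4 := D.νe.paramCoe (π * x, 0)

/-- The core curve is the core knot: `core x₀ = e (circlePoint (π x₀))`. [folklore] -/
theorem core_eq (x : ℝ) : D.core x = ((D.e (circlePoint (π * x)) : 𝕊 3) : 𝔼 4) := by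
  unfold core Knot.TubularNbhd.paramCoe
  rw [Knot.TubularNbhd.param_apply, D.νe.coe_apply_zero]

/-- The core curve lies on the unit sphere. [folklore] -/
theorem norm_core (x : ℝ) : ‖D.core x‖ = 1 := by
  rw [D.core_eq]; exact norm_eq_of_mem_sphere _

/-- The core curve is `C^∞`. [folklore] -/
theorem contDiff_core : ContDiff ℝ ∞ D.core :=
  D.νe.contDiff_paramCoe.comp ((contDiff_const.mul contDiff_id).prodMk contDiff_const)

/-- The fibre point of the left radial segment at `x₀`: `(rπx₀/2) e₀`. [folklore] -/
def q₁ (x : ℝ) : ℝ × 𝔼 2 := (0, (D.κ * π * x) • (EuclideanSpace.single 0 1 : 𝔼 2))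

/-- The fibre point of the right radial segment at `x₀`: `(rπ(x₀ - 1)/2) e₀`. [folklore] -/
def q₂ (x : ℝ) : ℝ × 𝔼 2 := (0, (D.κ * π * (x - 1)) • (EuclideanSpace.single 0 1 : 𝔼 2))

/-- **Left description of the core**: for `|x₀| ≤ ζ`, `core x₀ = ν₁ (circlePoint 0, (rπx₀/2) e₀)`.
[folklore] -/
theorem core_eq_left {x : ℝ} (hx : |x| ≤ D.ζ) : D.core x = D.ν₁.paramCoe (D.q₁ x) := by
  rw [D.core_eq]
  have hθ : |π * x| ≤ D.h := by
    rw [abs_mul, abs_of_pos Real.pi_pos, ← D.pi_mul_ζ]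
    exact mul_le_mul_of_nonneg_left hx Real.pi_pos.le
  rw [D.germ₁ _ hθ]
  unfold q₁ κ Knot.TubularNbhd.paramCoe
  rw [Knot.TubularNbhd.param_apply, show D.r / 2 * (π * x) = D.r / 2 * π * x by ring]

/-- **Right description of the core**: for `|x₀ - 1| ≤ ζ`,
`core x₀ = ν₂ (circlePoint 0, (rπ(x₀ - 1)/2) e₀)`. [folklore] -/
theorem core_eq_right {x : ℝ} (hx : |x - 1| ≤ D.ζ) : D.core x = D.ν₂.paramCoe (D.q₂ x) := by
  rw [D.core_eq]
  have hθ : |π * x - π| ≤ D.h := by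
    rw [show π * x - π = π * (x - 1) by ring, abs_mul, abs_of_pos Real.pi_pos, ← D.pi_mul_ζ]
    exact mul_le_mul_of_nonneg_left hx Real.pi_pos.le
  rw [D.germ₂ _ hθ]
  unfold q₂ κ Knot.TubularNbhd.paramCoe
  rw [Knot.TubularNbhd.param_apply, show D.r / 2 * (π * x - π) = D.r / 2 * π * (x - 1) by ring]

/-! ### The frames along the core and at the ends -/

/-- The fibre derivative `∂_w νe (circlePoint (πx₀), 0) · v` of the core tube: the normal field of
direction `v ∈ ℝ²` along the core. [folklore] -/
def N (x : ℝ) (v : 𝔼 2) : 𝔼 4 := fderiv ℝ D.νe.paramCoe (π * x, 0) (0, v)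

/-- The angular derivative `∂_θ νe (circlePoint (πx₀), 0)` of the core tube (a positive multiple
of the velocity of the core). [folklore] -/
def R₁ (x : ℝ) : 𝔼 4 := fderiv ℝ D.νe.paramCoe (π * x, 0) (1, 0)

/-- The first normal `∂_{w₁} νe` along the core. [folklore] -/
def R₂ (x : ℝ) : 𝔼 4 := D.N x (EuclideanSpace.single 0 1)

/-- The second normal `∂_{w₂} νe` along the core. [folklore] -/
def R₃ (x : ℝ) : 𝔼 4 := D.N x (EuclideanSpace.single 1 1)

/-- **The frame of the core tube has positive determinant** (`TubularNbhd.det_pos`). [folklore] -/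
theorem frameDet_core_pos (x : ℝ) : 0 < frameDet (D.core x) (D.R₁ x) (D.R₂ x) (D.R₃ x) := by
  have := D.νe.tubeFrameDet_paramCoe_pos (π * x, 0)
  rwa [tubeFrameDet_def] at this

/-- The normal field of direction `v` is the combination `v₀ ∂_{w₁} + v₁ ∂_{w₂}`. [folklore] -/
theorem N_eq (x : ℝ) (v : 𝔼 2) : D.N x v = v 0 • D.R₂ x + v 1 • D.R₃ x := by
  unfold R₂ R₃ N
  conv_lhs => rw [euclideanSpace_two_decomp v]
  rw [show ((0 : ℝ), v 0 • EuclideanSpace.single 0 (1 : ℝ) + v 1 • EuclideanSpace.single 1 (1 : ℝ)) =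
    v 0 • ((0 : ℝ), EuclideanSpace.single 0 (1 : ℝ)) + v 1 • ((0 : ℝ), (EuclideanSpace.single 1 (1 : ℝ) : 𝔼 2)) by
    ext <;> simp]
  rw [map_add, map_smul, map_smul]

/-- The fibre derivative of the core tube is `C^∞` in `x₀` along a `C^∞` direction field.
[folklore] -/
theorem contDiff_N_comp {v : ℝ → 𝔼 2} (hv : ContDiff ℝ ∞ v) : ContDiff ℝ ∞ fun x ↦ D.N x (v x) := by
  unfold N
  have h1 : ContDiff ℝ ∞ fun x : ℝ ↦ ((π * x, (0 : 𝔼 2)) : ℝ × 𝔼 2) :=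
    (contDiff_const.mul contDiff_id).prodMk contDiff_const
  have h2 : ContDiff ℝ ∞ fun x : ℝ ↦ (((0 : ℝ), v x) : ℝ × 𝔼 2) := contDiff_const.prodMk hv
  exact ((D.νe.contDiff_paramCoe.fderiv_right (m := ∞) (by simp)).comp h1).clm_apply h2

/-- `R₁` is `C^∞`. [folklore] -/
theorem contDiff_R₁ : ContDiff ℝ ∞ D.R₁ := by
  unfold R₁
  have h1 : ContDiff ℝ ∞ fun x : ℝ ↦ ((π * x, (0 : 𝔼 2)) : ℝ × 𝔼 2) :=
    (contDiff_const.mul contDiff_id).prodMk contDiff_const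
  exact ((D.νe.contDiff_paramCoe.fderiv_right (m := ∞) (by simp)).comp h1).clm_apply contDiff_const

/-- `R₂` is `C^∞`. [folklore] -/
theorem contDiff_R₂ : ContDiff ℝ ∞ D.R₂ := D.contDiff_N_comp contDiff_const

/-- `R₃` is `C^∞`. [folklore] -/
theorem contDiff_R₃ : ContDiff ℝ ∞ D.R₃ := D.contDiff_N_comp contDiff_const

/-- The velocity of the core is `π ∂_θ νe`. [folklore] -/
theorem hasDerivAt_core (x : ℝ) : HasDerivAt D.core (π • D.R₁ x) x := by
  unfold core R₁
  have hc : HasDerivAt (fun x : ℝ ↦ ((π * x, (0 : 𝔼 2)) : ℝ × 𝔼 2)) ((π, (0 : 𝔼 2)) : ℝ × 𝔼 2) x := by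
    have h1 : HasDerivAt (fun x : ℝ ↦ π * x) π x := by
      simpa using (hasDerivAt_id x).const_mul π
    exact h1.prodMk (hasDerivAt_const x (0 : 𝔼 2))
  have hd : HasFDerivAt D.νe.paramCoe (fderiv ℝ D.νe.paramCoe (π * x, 0)) (π * x, 0) :=
    ((D.νe.contDiff_paramCoe.differentiable (by simp)) _).hasFDerivAt
  refine (hd.comp_hasDerivAt x hc).congr_deriv ?_
  rw [show ((π, (0 : 𝔼 2)) : ℝ × 𝔼 2) = π • ((1 : ℝ), (0 : 𝔼 2)) by ext <;> simp, map_smul]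

/-- The velocity of the core. [folklore] -/
theorem deriv_core (x : ℝ) : deriv D.core x = π • D.R₁ x := (D.hasDerivAt_core x).deriv

/-! ### The end frames -/

/-- The angular derivative `∂_θ ν₁` at the point `q₁ x₀` of the left radial segment: the
derivative across the left strip, `V₁ = ∂_s P₁`. [folklore] -/
def V₁ (x : ℝ) : 𝔼 4 := fderiv ℝ D.ν₁.paramCoe (D.q₁ x) (1, 0)

/-- The first normal `∂_{w₁} ν₁` at `q₁ x₀` (a positive multiple of the velocity of the core on
the left germ zone). [folklore] -/
def S₁₂ (x : ℝ) : 𝔼 4 := fderiv ℝ D.ν₁.paramCoe (D.q₁ x) (0, EuclideanSpace.single 0 1)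

/-- The second normal `∂_{w₂} ν₁` at `q₁ x₀`. [folklore] -/
def S₁₃ (x : ℝ) : 𝔼 4 := fderiv ℝ D.ν₁.paramCoe (D.q₁ x) (0, EuclideanSpace.single 1 1)

/-- The angular derivative `∂_θ ν₂` at the point `q₂ x₀` of the right radial segment; the
derivative across the right strip is `V₂ = -∂_θ ν₂` (the right strip is traversed downwards).
[folklore] -/
def S₂₁ (x : ℝ) : 𝔼 4 := fderiv ℝ D.ν₂.paramCoe (D.q₂ x) (1, 0)

/-- `V₂ = -∂_θ ν₂ = ∂_s P₂`. [folklore] -/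
def V₂ (x : ℝ) : 𝔼 4 := -D.S₂₁ x

/-- The first normal `∂_{w₁} ν₂` at `q₂ x₀`. [folklore] -/
def S₂₂ (x : ℝ) : 𝔼 4 := fderiv ℝ D.ν₂.paramCoe (D.q₂ x) (0, EuclideanSpace.single 0 1)

/-- The second normal `∂_{w₂} ν₂` at `q₂ x₀`. [folklore] -/
def S₂₃ (x : ℝ) : 𝔼 4 := fderiv ℝ D.ν₂.paramCoe (D.q₂ x) (0, EuclideanSpace.single 1 1)

/-- The left end frame has positive determinant. [folklore] -/
theorem frameDet_left_pos (x : ℝ) :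
    0 < frameDet (D.ν₁.paramCoe (D.q₁ x)) (D.V₁ x) (D.S₁₂ x) (D.S₁₃ x) := by
  have := D.ν₁.tubeFrameDet_paramCoe_pos (D.q₁ x)
  rwa [tubeFrameDet_def] at this

/-- The right end frame has positive determinant. [folklore] -/
theorem frameDet_right_pos (x : ℝ) :
    0 < frameDet (D.ν₂.paramCoe (D.q₂ x)) (D.S₂₁ x) (D.S₂₂ x) (D.S₂₃ x) := by
  have := D.ν₂.tubeFrameDet_paramCoe_pos (D.q₂ x)
  rwa [tubeFrameDet_def] at this

/-- `q₁` is `C^∞`. [folklore] -/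
theorem contDiff_q₁ : ContDiff ℝ ∞ D.q₁ := by
  unfold q₁
  exact contDiff_const.prodMk ((contDiff_const.mul contDiff_id).smul contDiff_const)

/-- `q₂` is `C^∞`. [folklore] -/
theorem contDiff_q₂ : ContDiff ℝ ∞ D.q₂ := by
  unfold q₂
  exact contDiff_const.prodMk ((contDiff_const.mul (contDiff_id.sub contDiff_const)).smul
    contDiff_const)

/-- `V₁` is `C^∞`. [folklore] -/
theorem contDiff_V₁ : ContDiff ℝ ∞ D.V₁ :=
  ((D.ν₁.contDiff_paramCoe.fderiv_right (m := ∞) (by simp)).comp D.contDiff_q₁).clm_apply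
    contDiff_const

/-- `V₂` is `C^∞`. [folklore] -/
theorem contDiff_V₂ : ContDiff ℝ ∞ D.V₂ :=
  (((D.ν₂.contDiff_paramCoe.fderiv_right (m := ∞) (by simp)).comp D.contDiff_q₂).clm_apply
    contDiff_const).neg

/-- **The velocity of the core on the left germ zone**: for `|x₀| < ζ`,
`core' x₀ = κπ ∂_{w₁} ν₁ (q₁ x₀)`. [folklore] -/
theorem hasDerivAt_core_left {x : ℝ} (hx : |x| < D.ζ) :
    HasDerivAt D.core ((D.κ * π) • D.S₁₂ x) x := by
  -- near `x` the core is `ν₁.paramCoe ∘ q₁`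
  have hev : D.core =ᶠ[𝓝 x] fun y ↦ D.ν₁.paramCoe (D.q₁ y) := by
    have ho : IsOpen {y : ℝ | |y| < D.ζ} := isOpen_lt continuous_abs continuous_const
    filter_upwards [ho.mem_nhds hx] with y hy
    exact D.core_eq_left hy.le
  refine HasDerivAt.congr_of_eventuallyEq ?_ hev
  have hq : HasDerivAt D.q₁ (((0 : ℝ), (D.κ * π) • (EuclideanSpace.single 0 1 : 𝔼 2)) : ℝ × 𝔼 2) x := by
    unfold q₁
    refine (hasDerivAt_const x (0 : ℝ)).prodMk ?_
    have h1 : HasDerivAt (fun y : ℝ ↦ D.κ * π * y) (D.κ * π) x := by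
      simpa using (hasDerivAt_id x).const_mul (D.κ * π)
    exact h1.smul_const _
  have hd : HasFDerivAt D.ν₁.paramCoe (fderiv ℝ D.ν₁.paramCoe (D.q₁ x)) (D.q₁ x) :=
    ((D.ν₁.contDiff_paramCoe.differentiable (by simp)) _).hasFDerivAt
  refine (hd.comp_hasDerivAt x hq).congr_deriv ?_
  unfold S₁₂
  rw [show (((0 : ℝ), (D.κ * π) • (EuclideanSpace.single 0 1 : 𝔼 2)) : ℝ × 𝔼 2) =
    (D.κ * π) • ((0 : ℝ), (EuclideanSpace.single 0 1 : 𝔼 2)) by ext <;> simp, map_smul]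

/-- **The velocity of the core on the right germ zone**: for `|x₀ - 1| < ζ`,
`core' x₀ = κπ ∂_{w₁} ν₂ (q₂ x₀)`. [folklore] -/
theorem hasDerivAt_core_right {x : ℝ} (hx : |x - 1| < D.ζ) :
    HasDerivAt D.core ((D.κ * π) • D.S₂₂ x) x := by
  have hev : D.core =ᶠ[𝓝 x] fun y ↦ D.ν₂.paramCoe (D.q₂ y) := by
    have ho : IsOpen {y : ℝ | |y - 1| < D.ζ} :=
      isOpen_lt (continuous_abs.comp (continuous_id.sub continuous_const)) continuous_const
    filter_upwards [ho.mem_nhds hx] with y hy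
    exact D.core_eq_right hy.le
  refine HasDerivAt.congr_of_eventuallyEq ?_ hev
  have hq : HasDerivAt D.q₂ (((0 : ℝ), (D.κ * π) • (EuclideanSpace.single 0 1 : 𝔼 2)) : ℝ × 𝔼 2) x := by
    unfold q₂
    refine (hasDerivAt_const x (0 : ℝ)).prodMk ?_
    have h1 : HasDerivAt (fun y : ℝ ↦ D.κ * π * (y - 1)) (D.κ * π) x := by
      simpa using ((hasDerivAt_id x).sub_const 1).const_mul (D.κ * π)
    exact h1.smul_const _
  have hd : HasFDerivAt D.ν₂.paramCoe (fderiv ℝ D.ν₂.paramCoe (D.q₂ x)) (D.q₂ x) :=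
    ((D.ν₂.contDiff_paramCoe.differentiable (by simp)) _).hasFDerivAt
  refine (hd.comp_hasDerivAt x hq).congr_deriv ?_
  unfold S₂₂
  rw [show (((0 : ℝ), (D.κ * π) • (EuclideanSpace.single 0 1 : 𝔼 2)) : ℝ × 𝔼 2) =
    (D.κ * π) • ((0 : ℝ), (EuclideanSpace.single 0 1 : 𝔼 2)) by ext <;> simp, map_smul]

/-- On the left germ zone, `∂_θ νe = κ ∂_{w₁} ν₁` along the core (both are `core'/π`).
[folklore] -/
theorem R₁_eq_left {x : ℝ} (hx : |x| < D.ζ) : D.R₁ x = D.κ • D.S₁₂ x := by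
  have h1 := (D.hasDerivAt_core x).unique (D.hasDerivAt_core_left hx)
  rw [mul_comm, mul_smul] at h1
  exact smul_right_injective _ Real.pi_pos.ne' h1

/-- On the right germ zone, `∂_θ νe = κ ∂_{w₁} ν₂` along the core. [folklore] -/
theorem R₁_eq_right {x : ℝ} (hx : |x - 1| < D.ζ) : D.R₁ x = D.κ • D.S₂₂ x := by
  have h1 := (D.hasDerivAt_core x).unique (D.hasDerivAt_core_right hx)
  rw [mul_comm, mul_smul] at h1
  exact smul_right_injective _ Real.pi_pos.ne' h1

/-- On the left germ zone the core point is the base point of the left end frame. [folklore] -/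
theorem core_eq_left' {x : ℝ} (hx : |x| < D.ζ) : D.core x = D.ν₁.paramCoe (D.q₁ x) :=
  D.core_eq_left hx.le

/-! ### Solving for the normal field on the blending zones (Cramer's rule) -/

/-- The planar field on the left blending zone: the `(∂_{w₁}, ∂_{w₂})`-coordinates, in the frame
of the core tube, of the class of `V₁` modulo the tangent plane `span (core, core')` (Cramer's
rule). [folklore] -/
def wL (x : ℝ) : 𝔼 2 :=
  (frameDet (D.core x) (D.R₁ x) (D.V₁ x) (D.R₃ x) / frameDet (D.core x) (D.R₁ x) (D.R₂ x) (D.R₃ x)) •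
      EuclideanSpace.single 0 1 +
    (frameDet (D.core x) (D.R₁ x) (D.R₂ x) (D.V₁ x) / frameDet (D.core x) (D.R₁ x) (D.R₂ x) (D.R₃ x)) •
      EuclideanSpace.single 1 1

/-- The planar field on the right blending zone (the same for `V₂`). [folklore] -/
def wR (x : ℝ) : 𝔼 2 :=
  (frameDet (D.core x) (D.R₁ x) (D.V₂ x) (D.R₃ x) / frameDet (D.core x) (D.R₁ x) (D.R₂ x) (D.R₃ x)) •
      EuclideanSpace.single 0 1 +
    (frameDet (D.core x) (D.R₁ x) (D.R₂ x) (D.V₂ x) / frameDet (D.core x) (D.R₁ x) (D.R₂ x) (D.R₃ x)) •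
      EuclideanSpace.single 1 1

/-- First coordinate of `wL`. [folklore] -/
@[simp] theorem wL_apply_zero (x : ℝ) : D.wL x 0 =
    frameDet (D.core x) (D.R₁ x) (D.V₁ x) (D.R₃ x) / frameDet (D.core x) (D.R₁ x) (D.R₂ x) (D.R₃ x) := by
  simp [wL]

/-- Second coordinate of `wL`. [folklore] -/
@[simp] theorem wL_apply_one (x : ℝ) : D.wL x 1 =
    frameDet (D.core x) (D.R₁ x) (D.R₂ x) (D.V₁ x) / frameDet (D.core x) (D.R₁ x) (D.R₂ x) (D.R₃ x) := by
  simp [wL]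

/-- First coordinate of `wR`. [folklore] -/
@[simp] theorem wR_apply_zero (x : ℝ) : D.wR x 0 =
    frameDet (D.core x) (D.R₁ x) (D.V₂ x) (D.R₃ x) / frameDet (D.core x) (D.R₁ x) (D.R₂ x) (D.R₃ x) := by
  simp [wR]

/-- Second coordinate of `wR`. [folklore] -/
@[simp] theorem wR_apply_one (x : ℝ) : D.wR x 1 =
    frameDet (D.core x) (D.R₁ x) (D.R₂ x) (D.V₂ x) / frameDet (D.core x) (D.R₁ x) (D.R₂ x) (D.R₃ x) := by
  simp [wR]

/-- `wL` is `C^∞` (the determinant in the denominator is positive). [folklore] -/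
theorem contDiff_wL : ContDiff ℝ ∞ D.wL := by
  have hd : ContDiff ℝ ∞ fun x ↦ frameDet (D.core x) (D.R₁ x) (D.R₂ x) (D.R₃ x) :=
    contDiff_frameDet D.contDiff_core D.contDiff_R₁ D.contDiff_R₂ D.contDiff_R₃
  have hne : ∀ x, frameDet (D.core x) (D.R₁ x) (D.R₂ x) (D.R₃ x) ≠ 0 :=
    fun x ↦ (D.frameDet_core_pos x).ne'
  unfold wL
  exact (((contDiff_frameDet D.contDiff_core D.contDiff_R₁ D.contDiff_V₁ D.contDiff_R₃).div hd
    hne).smul contDiff_const).add (((contDiff_frameDet D.contDiff_core D.contDiff_R₁ D.contDiff_R₂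
      D.contDiff_V₁).div hd hne).smul contDiff_const)

/-- `wR` is `C^∞`. [folklore] -/
theorem contDiff_wR : ContDiff ℝ ∞ D.wR := by
  have hd : ContDiff ℝ ∞ fun x ↦ frameDet (D.core x) (D.R₁ x) (D.R₂ x) (D.R₃ x) :=
    contDiff_frameDet D.contDiff_core D.contDiff_R₁ D.contDiff_R₂ D.contDiff_R₃
  have hne : ∀ x, frameDet (D.core x) (D.R₁ x) (D.R₂ x) (D.R₃ x) ≠ 0 :=
    fun x ↦ (D.frameDet_core_pos x).ne'
  unfold wR
  exact (((contDiff_frameDet D.contDiff_core D.contDiff_R₁ D.contDiff_V₂ D.contDiff_R₃).div hd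
    hne).smul contDiff_const).add (((contDiff_frameDet D.contDiff_core D.contDiff_R₁ D.contDiff_R₂
      D.contDiff_V₂).div hd hne).smul contDiff_const)

/-- `N x 0 = 0`. [folklore] -/
@[simp] theorem N_zero (x : ℝ) : D.N x 0 = 0 := by
  unfold N
  rw [show (((0 : ℝ), (0 : 𝔼 2)) : ℝ × 𝔼 2) = 0 from rfl, map_zero]

/-- **Cramer's rule on the left**: `V₁ - N (wL)` lies in the tangent plane `span (core, ∂_θ νe)`.
[folklore] -/
theorem exists_V₁_sub_N_wL (x : ℝ) : ∃ α β : ℝ, D.V₁ x - D.N x (D.wL x) = α • D.core x + β • D.R₁ x := by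
  obtain ⟨α, β, h⟩ := exists_eq_add_cramer (D.frameDet_core_pos x).ne' (D.V₁ x)
  refine ⟨α, β, ?_⟩
  rw [D.N_eq, ← h, D.wL_apply_zero, D.wL_apply_one]
  abel

/-- **Cramer's rule on the right**: `V₂ - N (wR)` lies in the tangent plane. [folklore] -/
theorem exists_V₂_sub_N_wR (x : ℝ) : ∃ α β : ℝ, D.V₂ x - D.N x (D.wR x) = α • D.core x + β • D.R₁ x := by
  obtain ⟨α, β, h⟩ := exists_eq_add_cramer (D.frameDet_core_pos x).ne' (D.V₂ x)
  refine ⟨α, β, ?_⟩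
  rw [D.N_eq, ← h, D.wR_apply_zero, D.wR_apply_one]
  abel

/-- **The left field does not vanish on the left germ zone**: there `core`, `core' ∥ ∂_{w₁} ν₁`
and `V₁ = ∂_θ ν₁` are part of the frame of `ν₁`, so `V₁ ∉ span (core, core')`. [folklore] -/
theorem wL_ne_zero {x : ℝ} (hx : |x| < D.ζ) : D.wL x ≠ 0 := by
  intro h0
  obtain ⟨α, β, h⟩ := D.exists_V₁_sub_N_wL x
  rw [h0, D.N_zero, sub_zero, D.R₁_eq_left hx, D.core_eq_left' hx, smul_smul] at h
  -- `V₁ = α • S₀ + (βκ) • S₁₂`: contradicts the nonvanishing left frame determinant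
  have key : (-α) • D.ν₁.paramCoe (D.q₁ x) + (1 : ℝ) • D.V₁ x + (-(β * D.κ)) • D.S₁₂ x +
      (0 : ℝ) • D.S₁₃ x = 0 := by
    rw [h]; simp only [neg_smul, one_smul, zero_smul, add_zero]; abel
  have := (eq_zero_of_frameDet_ne_zero_four (D.frameDet_left_pos x).ne' key).2.1
  exact one_ne_zero this

/-- **The right field does not vanish on the right germ zone.** [folklore] -/
theorem wR_ne_zero {x : ℝ} (hx : |x - 1| < D.ζ) : D.wR x ≠ 0 := by
  intro h0
  obtain ⟨α, β, h⟩ := D.exists_V₂_sub_N_wR x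
  rw [h0, D.N_zero, sub_zero, D.R₁_eq_right hx, D.core_eq_right hx.le, smul_smul] at h
  unfold V₂ at h
  have key : α • D.ν₂.paramCoe (D.q₂ x) + (1 : ℝ) • D.S₂₁ x + (β * D.κ) • D.S₂₂ x +
      (0 : ℝ) • D.S₂₃ x = 0 := by
    rw [one_smul, zero_smul, add_zero, ← neg_eq_iff_eq_neg.2 h.symm]; abel
  have := (eq_zero_of_frameDet_ne_zero_four (D.frameDet_right_pos x).ne' key).2.1
  exact one_ne_zero this

/-! ### The interpolated planar field and the normal field of the middle strip -/

/-- `2a < 1 - 2a`. [folklore] -/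
theorem two_a_lt : 2 * D.a < 1 - 2 * D.a := by have := D.a_le; linarith

/-- `2a < ζ`: the blending zones lie inside the germ zones. [folklore] -/
theorem two_a_lt_ζ : 2 * D.a < D.ζ := by have := D.four_mul_a; have := D.a_pos; linarith

/-- The interpolated planar field: `wL` on `(-∞, 2a]`, `wR` on `[1 - 2a, ∞)`, nonvanishing on
`[2a, 1 - 2a]` (`exists_contDiff_interpolate_ne_zero`). [folklore] -/
theorem exists_w : ∃ w : ℝ → 𝔼 2, ContDiff ℝ ∞ w ∧ (∀ x ≤ 2 * D.a, w x = D.wL x) ∧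
    (∀ x, 1 - 2 * D.a ≤ x → w x = D.wR x) ∧ ∀ x ∈ Icc (2 * D.a) (1 - 2 * D.a), w x ≠ 0 := by
  refine exists_contDiff_interpolate_ne_zero D.contDiff_wL D.contDiff_wR D.two_a_lt
    (D.wL_ne_zero ?_) (D.wR_ne_zero ?_)
  · rw [abs_of_pos (by linarith [D.a_pos])]; exact D.two_a_lt_ζ
  · rw [show 1 - 2 * D.a - 1 = -(2 * D.a) by ring, abs_neg, abs_of_pos (by linarith [D.a_pos])]
    exact D.two_a_lt_ζ

/-- **The planar field** `w` of the middle strip (a choice from `exists_w`). [folklore] -/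
def w : ℝ → 𝔼 2 := D.exists_w.choose

/-- `w` is `C^∞`. [folklore] -/
theorem contDiff_w : ContDiff ℝ ∞ D.w := D.exists_w.choose_spec.1

/-- `w = wL` on `(-∞, 2a]`. [folklore] -/
theorem w_eq_wL {x : ℝ} (hx : x ≤ 2 * D.a) : D.w x = D.wL x := D.exists_w.choose_spec.2.1 x hx

/-- `w = wR` on `[1 - 2a, ∞)`. [folklore] -/
theorem w_eq_wR {x : ℝ} (hx : 1 - 2 * D.a ≤ x) : D.w x = D.wR x :=
  D.exists_w.choose_spec.2.2.1 x hx

/-- `w ≠ 0` on `[2a, 1 - 2a]`. [folklore] -/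
theorem w_ne_zero {x : ℝ} (hx : x ∈ Icc (2 * D.a) (1 - 2 * D.a)) : D.w x ≠ 0 :=
  D.exists_w.choose_spec.2.2.2 x hx

/-- **The normal field of the middle strip**: `Nw x₀ = ∂_w νe (circlePoint (πx₀), 0) · w x₀`.
[folklore] -/
def Nw (x : ℝ) : 𝔼 4 := D.N x (D.w x)

/-- `Nw` is `C^∞`. [folklore] -/
theorem contDiff_Nw : ContDiff ℝ ∞ D.Nw := D.contDiff_N_comp D.contDiff_w

/-! ### The cut-offs -/

/-- The left cut-off: `1` on `(-∞, a]`, `0` on `[2a, ∞)`. [folklore] -/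
def χ₁ (x : ℝ) : ℝ := Real.smoothTransition ((2 * D.a - x) / D.a)

/-- The right cut-off: `0` on `(-∞, 1 - 2a]`, `1` on `[1 - a, ∞)`. [folklore] -/
def χ₂ (x : ℝ) : ℝ := Real.smoothTransition ((x - (1 - 2 * D.a)) / D.a)

/-- `χ₁` is `C^∞`. [folklore] -/
theorem contDiff_χ₁ : ContDiff ℝ ∞ D.χ₁ :=
  Real.smoothTransition.contDiff.comp ((contDiff_const.sub contDiff_id).div_const _)

/-- `χ₂` is `C^∞`. [folklore] -/
theorem contDiff_χ₂ : ContDiff ℝ ∞ D.χ₂ :=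
  Real.smoothTransition.contDiff.comp ((contDiff_id.sub contDiff_const).div_const _)

/-- `χ₁ = 1` on `(-∞, a]`. [folklore] -/
theorem χ₁_eq_one {x : ℝ} (hx : x ≤ D.a) : D.χ₁ x = 1 :=
  Real.smoothTransition.one_of_one_le (by rw [le_div_iff₀ D.a_pos]; linarith)

/-- `χ₁ = 0` on `[2a, ∞)`. [folklore] -/
theorem χ₁_eq_zero {x : ℝ} (hx : 2 * D.a ≤ x) : D.χ₁ x = 0 :=
  Real.smoothTransition.zero_of_nonpos (div_nonpos_of_nonpos_of_nonneg (by linarith) D.a_pos.le)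

/-- `χ₂ = 0` on `(-∞, 1 - 2a]`. [folklore] -/
theorem χ₂_eq_zero {x : ℝ} (hx : x ≤ 1 - 2 * D.a) : D.χ₂ x = 0 :=
  Real.smoothTransition.zero_of_nonpos (div_nonpos_of_nonpos_of_nonneg (by linarith) D.a_pos.le)

/-- `χ₂ = 1` on `[1 - a, ∞)`. [folklore] -/
theorem χ₂_eq_one {x : ℝ} (hx : 1 - D.a ≤ x) : D.χ₂ x = 1 :=
  Real.smoothTransition.one_of_one_le (by rw [le_div_iff₀ D.a_pos]; linarith)

/-! ### The three strips and the blended map -/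

/-- **The left strip** `P₁ (x₀, s) = ν₁ (circlePoint s, (κπx₀) e₀)`, in `ℝ⁴`. [folklore] -/
def P₁ (p : ℝ × ℝ) : 𝔼 4 :=
  D.ν₁.paramCoe (p.2, (D.κ * π * p.1) • (EuclideanSpace.single 0 1 : 𝔼 2))

/-- **The right strip** `P₂ (x₀, s) = ν₂ (circlePoint (-s), (κπ(x₀ - 1)) e₀)`. [folklore] -/
def P₂ (p : ℝ × ℝ) : 𝔼 4 :=
  D.ν₂.paramCoe (-p.2, (D.κ * π * (p.1 - 1)) • (EuclideanSpace.single 0 1 : 𝔼 2))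

/-- **The middle strip** `M (x₀, s) = core x₀ + s Nw x₀`. [folklore] -/
def M (p : ℝ × ℝ) : 𝔼 4 := D.core p.1 + p.2 • D.Nw p.1

/-- **The blended map** `A = χ₁ P₁ + χ₂ P₂ + (1 - χ₁ - χ₂) M : ℝ² → ℝ⁴`. [folklore] -/
def A (p : ℝ × ℝ) : 𝔼 4 :=
  D.χ₁ p.1 • D.P₁ p + D.χ₂ p.1 • D.P₂ p + (1 - D.χ₁ p.1 - D.χ₂ p.1) • D.M p

/-- The left strip is `C^∞`. [folklore] -/
theorem contDiff_P₁ : ContDiff ℝ ∞ D.P₁ := by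
  unfold P₁
  exact D.ν₁.contDiff_paramCoe.comp
    (contDiff_snd.prodMk ((contDiff_const.mul contDiff_fst).smul contDiff_const))

/-- The right strip is `C^∞`. [folklore] -/
theorem contDiff_P₂ : ContDiff ℝ ∞ D.P₂ := by
  unfold P₂
  exact D.ν₂.contDiff_paramCoe.comp
    (contDiff_snd.neg.prodMk ((contDiff_const.mul (contDiff_fst.sub contDiff_const)).smul
      contDiff_const))

/-- The middle strip is `C^∞`. [folklore] -/
theorem contDiff_M : ContDiff ℝ ∞ D.M := by
  unfold M
  exact (D.contDiff_core.comp contDiff_fst).add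
    (contDiff_snd.smul (D.contDiff_Nw.comp contDiff_fst))

/-- The blended map is `C^∞`. [folklore] -/
theorem contDiff_A : ContDiff ℝ ∞ D.A := by
  unfold A
  have h1 : ContDiff ℝ ∞ fun p : ℝ × ℝ ↦ D.χ₁ p.1 := D.contDiff_χ₁.comp contDiff_fst
  have h2 : ContDiff ℝ ∞ fun p : ℝ × ℝ ↦ D.χ₂ p.1 := D.contDiff_χ₂.comp contDiff_fst
  exact ((h1.smul D.contDiff_P₁).add (h2.smul D.contDiff_P₂)).add
    (((contDiff_const.sub h1).sub h2).smul D.contDiff_M)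

/-- The left strip on the core line: `P₁ (x₀, 0) = ν₁.paramCoe (q₁ x₀)`. [folklore] -/
theorem P₁_zero (x : ℝ) : D.P₁ (x, 0) = D.ν₁.paramCoe (D.q₁ x) := rfl

/-- The right strip on the core line. [folklore] -/
theorem P₂_zero (x : ℝ) : D.P₂ (x, 0) = D.ν₂.paramCoe (D.q₂ x) := by
  unfold P₂ q₂; simp

/-- The middle strip on the core line is the core. [folklore] -/
theorem M_zero (x : ℝ) : D.M (x, 0) = D.core x := by unfold M; simp

/-- The strips take values on the unit sphere: `‖P₁ p‖ = 1`. [folklore] -/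
theorem norm_P₁ (p : ℝ × ℝ) : ‖D.P₁ p‖ = 1 := by
  unfold P₁ Knot.TubularNbhd.paramCoe
  exact norm_eq_of_mem_sphere _

/-- `‖P₂ p‖ = 1`. [folklore] -/
theorem norm_P₂ (p : ℝ × ℝ) : ‖D.P₂ p‖ = 1 := by
  unfold P₂ Knot.TubularNbhd.paramCoe
  exact norm_eq_of_mem_sphere _

/-- **On the left zone the blended map is the left strip**: `A = P₁` for `x₀ ≤ a`. [folklore] -/
theorem A_eq_P₁ {p : ℝ × ℝ} (hp : p.1 ≤ D.a) : D.A p = D.P₁ p := by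
  unfold A
  rw [D.χ₁_eq_one hp, D.χ₂_eq_zero (by have := D.a_le; linarith)]
  simp

/-- **On the right zone the blended map is the right strip**: `A = P₂` for `1 - a ≤ x₀`.
[folklore] -/
theorem A_eq_P₂ {p : ℝ × ℝ} (hp : 1 - D.a ≤ p.1) : D.A p = D.P₂ p := by
  unfold A
  rw [D.χ₁_eq_zero (by have := D.a_le; linarith), D.χ₂_eq_one hp]
  simp

/-- **Along the core the blended map is the core**: `A (x₀, 0) = core x₀` on `(-ζ, 1 + ζ)`
(where `χ₁ ≠ 0` the left description of the core applies, where `χ₂ ≠ 0` the right one).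
[folklore] -/
theorem A_zero {x : ℝ} (hx : x ∈ Ioo (-D.ζ) (1 + D.ζ)) : D.A (x, 0) = D.core x := by
  unfold A
  simp only [D.M_zero, D.P₂_zero]
  rw [D.P₁_zero]
  have h4 := D.four_mul_a
  have ha := D.a_pos
  have h1 : D.χ₁ x • D.ν₁.paramCoe (D.q₁ x) = D.χ₁ x • D.core x := by
    by_cases hx1 : 2 * D.a ≤ x
    · rw [D.χ₁_eq_zero hx1, zero_smul, zero_smul]
    · rw [D.core_eq_left]
      rw [abs_le]
      constructor <;> linarith [hx.1]
  have h2 : D.χ₂ x • D.ν₂.paramCoe (D.q₂ x) = D.χ₂ x • D.core x := by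
    by_cases hx2 : x ≤ 1 - 2 * D.a
    · rw [D.χ₂_eq_zero hx2, zero_smul, zero_smul]
    · rw [D.core_eq_right]
      rw [abs_le]
      constructor <;> linarith [hx.2]
  rw [h1, h2, ← add_smul, ← add_smul]
  ring_nf
  simp

/-! ### Partial derivatives of the blended map along the core -/

/-- The derivative across the strips: `T x₀ = χ₁ V₁ + χ₂ V₂ + (1 - χ₁ - χ₂) Nw` (the value of
`∂_s A` on the core line). [folklore] -/
def T (x : ℝ) : 𝔼 4 := D.χ₁ x • D.V₁ x + D.χ₂ x • D.V₂ x + (1 - D.χ₁ x - D.χ₂ x) • D.Nw x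

/-- A partial derivative in the first variable is a Fréchet derivative on `(1, 0)`. [folklore] -/
theorem deriv_fst_eq_fderiv' {G : ℝ × ℝ → 𝔼 4} {x s : ℝ} (hG : DifferentiableAt ℝ G (x, s)) :
    deriv (fun t ↦ G (t, s)) x = fderiv ℝ G (x, s) (1, 0) := by
  have hc : HasDerivAt (fun t : ℝ ↦ ((t, s) : ℝ × ℝ)) ((1 : ℝ), (0 : ℝ)) x :=
    (hasDerivAt_id x).prodMk (hasDerivAt_const x s)
  exact (hG.hasFDerivAt.comp_hasDerivAt x hc).deriv

/-- A partial derivative in the second variable is a Fréchet derivative on `(0, 1)`. [folklore] -/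
theorem deriv_snd_eq_fderiv' {G : ℝ × ℝ → 𝔼 4} {x s : ℝ} (hG : DifferentiableAt ℝ G (x, s)) :
    deriv (fun t ↦ G (x, t)) s = fderiv ℝ G (x, s) (0, 1) := by
  have hc : HasDerivAt (fun t : ℝ ↦ ((x, t) : ℝ × ℝ)) ((0 : ℝ), (1 : ℝ)) s :=
    (hasDerivAt_const s x).prodMk (hasDerivAt_id s)
  exact (hG.hasFDerivAt.comp_hasDerivAt s hc).deriv

/-- The blended map is differentiable. [folklore] -/
theorem differentiable_A : Differentiable ℝ D.A := D.contDiff_A.differentiable (by simp)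

/-- **`∂₀ A = core'` along the core** (on `(-ζ, 1 + ζ)`, where `A (·, 0) = core`). [folklore] -/
theorem fderiv_A_fst {x : ℝ} (hx : x ∈ Ioo (-D.ζ) (1 + D.ζ)) :
    fderiv ℝ D.A (x, 0) (1, 0) = deriv D.core x := by
  rw [← deriv_fst_eq_fderiv' (D.differentiable_A _)]
  apply Filter.EventuallyEq.deriv_eq
  filter_upwards [isOpen_Ioo.mem_nhds hx] with y hy
  exact D.A_zero hy

/-- The derivative across the left strip on the core line is `V₁`. [folklore] -/
theorem hasDerivAt_P₁_snd (x : ℝ) : HasDerivAt (fun s ↦ D.P₁ (x, s)) (D.V₁ x) 0 := by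
  unfold P₁ V₁
  have hc : HasDerivAt (fun s : ℝ ↦ ((s, (D.κ * π * x) • (EuclideanSpace.single 0 1 : 𝔼 2)) : ℝ × 𝔼 2))
      (((1 : ℝ), (0 : 𝔼 2)) : ℝ × 𝔼 2) 0 :=
    (hasDerivAt_id (0 : ℝ)).prodMk (hasDerivAt_const _ _)
  have hd : HasFDerivAt D.ν₁.paramCoe (fderiv ℝ D.ν₁.paramCoe (D.q₁ x))
      (((0 : ℝ), (D.κ * π * x) • (EuclideanSpace.single 0 1 : 𝔼 2)) : ℝ × 𝔼 2) :=
    ((D.ν₁.contDiff_paramCoe.differentiable (by simp)) _).hasFDerivAt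
  exact hd.comp_hasDerivAt (0 : ℝ) hc

/-- The derivative across the right strip on the core line is `V₂ = -∂_θ ν₂`. [folklore] -/
theorem hasDerivAt_P₂_snd (x : ℝ) : HasDerivAt (fun s ↦ D.P₂ (x, s)) (D.V₂ x) 0 := by
  unfold P₂ V₂ S₂₁
  have hc : HasDerivAt (fun s : ℝ ↦ ((-s, (D.κ * π * (x - 1)) • (EuclideanSpace.single 0 1 : 𝔼 2)) : ℝ × 𝔼 2))
      (((-1 : ℝ), (0 : 𝔼 2)) : ℝ × 𝔼 2) 0 :=
    (hasDerivAt_id (0 : ℝ)).neg.prodMk (hasDerivAt_const _ _)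
  have hd : HasFDerivAt D.ν₂.paramCoe (fderiv ℝ D.ν₂.paramCoe (D.q₂ x))
      (((-(0 : ℝ)), (D.κ * π * (x - 1)) • (EuclideanSpace.single 0 1 : 𝔼 2)) : ℝ × 𝔼 2) := by
    rw [neg_zero]
    exact ((D.ν₂.contDiff_paramCoe.differentiable (by simp)) _).hasFDerivAt
  refine (hd.comp_hasDerivAt (0 : ℝ) hc).congr_deriv ?_
  rw [show (((-1 : ℝ), (0 : 𝔼 2)) : ℝ × 𝔼 2) = -((1 : ℝ), (0 : 𝔼 2)) by ext <;> simp, map_neg]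

/-- The derivative across the middle strip is its normal field. [folklore] -/
theorem hasDerivAt_M_snd (x : ℝ) : HasDerivAt (fun s ↦ D.M (x, s)) (D.Nw x) 0 := by
  unfold M
  simpa using ((hasDerivAt_id (0 : ℝ)).smul_const (D.Nw x)).const_add (D.core x)

/-- **`∂_s A = T` along the core.** [folklore] -/
theorem hasDerivAt_A_snd (x : ℝ) : HasDerivAt (fun s ↦ D.A (x, s)) (D.T x) 0 := by
  unfold A T
  exact (((D.hasDerivAt_P₁_snd x).const_smul (D.χ₁ x)).add
    ((D.hasDerivAt_P₂_snd x).const_smul (D.χ₂ x))).add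
    ((D.hasDerivAt_M_snd x).const_smul (1 - D.χ₁ x - D.χ₂ x))

/-- `∂_s A = T` along the core, Fréchet form. [folklore] -/
theorem fderiv_A_snd (x : ℝ) : fderiv ℝ D.A (x, 0) (0, 1) = D.T x := by
  rw [← deriv_snd_eq_fderiv' (D.differentiable_A _)]
  exact (D.hasDerivAt_A_snd x).deriv

/-! ### Linear independence of `(core, core', ∂_s A)` along the core -/

/-- **Left zone** (`-2a ≤ x₀ ≤ 2a`): `∂_s A ≡ V₁ = ∂_θ ν₁` modulo the tangent plane, while
`core`, `core' ∥ ∂_{w₁} ν₁` are the other members of the frame of `ν₁`. [folklore] -/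
theorem linearIndependent_left {x : ℝ} (hx : x ∈ Icc (-(2 * D.a)) (2 * D.a)) :
    LinearIndependent ℝ ![D.core x, deriv D.core x, D.T x] := by
  have h2ζ := D.two_a_lt_ζ
  have hxζ : |x| < D.ζ := abs_lt.2 ⟨by linarith [hx.1], by linarith [hx.2]⟩
  have hκπ : D.κ * π ≠ 0 := mul_ne_zero D.κ_pos.ne' Real.pi_pos.ne'
  obtain ⟨α, β, hαβ⟩ := D.exists_V₁_sub_N_wL x
  -- `T = V₁ + s • core + t • S₁₂`
  have hχ₂ : D.χ₂ x = 0 := D.χ₂_eq_zero (by linarith [hx.2, D.two_a_lt])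
  have hNw : D.Nw x = D.V₁ x - (α • D.core x + β • D.R₁ x) := by
    unfold Nw
    rw [D.w_eq_wL hx.2, ← hαβ, sub_sub_cancel]
  have hT : D.T x = D.V₁ x + (-((1 - D.χ₁ x) * α)) • D.ν₁.paramCoe (D.q₁ x) +
      (-((1 - D.χ₁ x) * β * D.κ)) • D.S₁₂ x := by
    unfold T
    rw [hχ₂, hNw, D.R₁_eq_left hxζ, D.core_eq_left' hxζ]
    module
  have hT' : D.T x = D.V₁ x + (-((1 - D.χ₁ x) * α)) • D.ν₁.paramCoe (D.q₁ x) +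
      (-((1 - D.χ₁ x) * β * D.κ) / (D.κ * π)) • ((D.κ * π) • D.S₁₂ x) := by
    rw [hT, smul_smul, div_mul_cancel₀ _ hκπ]
  have hdet : frameDet (D.ν₁.paramCoe (D.q₁ x)) ((D.κ * π) • D.S₁₂ x) (D.T x) (D.S₁₃ x) ≠ 0 := by
    rw [hT', frameDet_row_two_add, ← one_smul ℝ (D.V₁ x), frameDet_swap_smul]
    exact mul_ne_zero (neg_ne_zero.2 (by rw [mul_one]; exact hκπ)) (D.frameDet_left_pos x).ne'
  have hcore : D.core x = D.ν₁.paramCoe (D.q₁ x) := D.core_eq_left' hxζ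
  have hderiv : deriv D.core x = (D.κ * π) • D.S₁₂ x := (D.hasDerivAt_core_left hxζ).deriv
  rw [hcore, hderiv]
  exact linearIndependent_fin_three_of_frameDet_ne_zero hdet

/-- **Middle zone** (`2a ≤ x₀ ≤ 1 - 2a`): `∂_s A = Nw = w₀ ∂_{w₁} νe + w₁ ∂_{w₂} νe` with
`w ≠ 0`, against the frame of `νe`. [folklore] -/
theorem linearIndependent_mid {x : ℝ} (hx : x ∈ Icc (2 * D.a) (1 - 2 * D.a)) :
    LinearIndependent ℝ ![D.core x, deriv D.core x, D.T x] := by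
  have hT : D.T x = D.w x 0 • D.R₂ x + D.w x 1 • D.R₃ x := by
    unfold T
    rw [D.χ₁_eq_zero hx.1, D.χ₂_eq_zero hx.2]
    simp only [zero_smul, zero_add, sub_zero, one_smul]
    exact D.N_eq x (D.w x)
  have hw : D.w x 0 * D.w x 0 - D.w x 1 * -(D.w x 1) ≠ 0 := by
    intro h0
    apply D.w_ne_zero hx
    have h0' : D.w x 0 ^ 2 + D.w x 1 ^ 2 = 0 := by nlinarith
    have h00 : D.w x 0 = 0 := by nlinarith
    have h01 : D.w x 1 = 0 := by nlinarith
    rw [euclideanSpace_two_decomp (D.w x), h00, h01, zero_smul, zero_smul, add_zero]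
  have hdet : frameDet (D.core x) (π • D.R₁ x) (D.T x) (-(D.w x 1) • D.R₂ x + D.w x 0 • D.R₃ x) ≠ 0 := by
    rw [hT, frameDet_smul_row_one, frameDet_comb₂]
    exact mul_ne_zero Real.pi_pos.ne' (mul_ne_zero hw (D.frameDet_core_pos x).ne')
  rw [D.deriv_core]
  exact linearIndependent_fin_three_of_frameDet_ne_zero hdet

/-- **Right zone** (`1 - 2a ≤ x₀ ≤ 1 + 2a`): `∂_s A ≡ V₂ = -∂_θ ν₂` modulo the tangent plane.
[folklore] -/
theorem linearIndependent_right {x : ℝ} (hx : x ∈ Icc (1 - 2 * D.a) (1 + 2 * D.a)) :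
    LinearIndependent ℝ ![D.core x, deriv D.core x, D.T x] := by
  have h2ζ := D.two_a_lt_ζ
  have hxζ : |x - 1| < D.ζ := abs_lt.2 ⟨by linarith [hx.1], by linarith [hx.2]⟩
  have hκπ : D.κ * π ≠ 0 := mul_ne_zero D.κ_pos.ne' Real.pi_pos.ne'
  obtain ⟨α, β, hαβ⟩ := D.exists_V₂_sub_N_wR x
  have hχ₁ : D.χ₁ x = 0 := D.χ₁_eq_zero (by linarith [hx.1, D.two_a_lt])
  have hNw : D.Nw x = D.V₂ x - (α • D.core x + β • D.R₁ x) := by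
    unfold Nw
    rw [D.w_eq_wR hx.1, ← hαβ, sub_sub_cancel]
  have hT : D.T x = (-1 : ℝ) • D.S₂₁ x + (-((1 - D.χ₂ x) * α)) • D.ν₂.paramCoe (D.q₂ x) +
      (-((1 - D.χ₂ x) * β * D.κ)) • D.S₂₂ x := by
    unfold T
    rw [hχ₁, hNw, D.R₁_eq_right hxζ, D.core_eq_right hxζ.le]
    unfold V₂
    module
  have hT' : D.T x = (-1 : ℝ) • D.S₂₁ x + (-((1 - D.χ₂ x) * α)) • D.ν₂.paramCoe (D.q₂ x) +
      (-((1 - D.χ₂ x) * β * D.κ) / (D.κ * π)) • ((D.κ * π) • D.S₂₂ x) := by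
    rw [hT, smul_smul, div_mul_cancel₀ _ hκπ]
  have hdet : frameDet (D.ν₂.paramCoe (D.q₂ x)) ((D.κ * π) • D.S₂₂ x) (D.T x) (D.S₂₃ x) ≠ 0 := by
    rw [hT', frameDet_row_two_add, frameDet_swap_smul]
    refine mul_ne_zero (neg_ne_zero.2 ?_) (D.frameDet_right_pos x).ne'
    rw [mul_neg_one]; exact neg_ne_zero.2 hκπ
  have hcore : D.core x = D.ν₂.paramCoe (D.q₂ x) := D.core_eq_right hxζ.le
  have hderiv : deriv D.core x = (D.κ * π) • D.S₂₂ x := (D.hasDerivAt_core_right hxζ).deriv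
  rw [hcore, hderiv]
  exact linearIndependent_fin_three_of_frameDet_ne_zero hdet

/-- **Along the core, `(A, ∂₀ A, ∂_s A)` are linearly independent** (for `x₀ ∈ [-2a, 1 + 2a]`).
[folklore] -/
theorem linearIndependent_core {x : ℝ} (hx : x ∈ Icc (-(2 * D.a)) (1 + 2 * D.a)) :
    LinearIndependent ℝ ![D.A (x, 0), fderiv ℝ D.A (x, 0) (1, 0), fderiv ℝ D.A (x, 0) (0, 1)] := by
  have h2ζ := D.two_a_lt_ζ
  have hxo : x ∈ Ioo (-D.ζ) (1 + D.ζ) := ⟨by linarith [hx.1], by linarith [hx.2]⟩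
  rw [D.A_zero hxo, D.fderiv_A_fst hxo, D.fderiv_A_snd]
  rcases le_or_gt x (2 * D.a) with h1 | h1
  · exact D.linearIndependent_left ⟨hx.1, h1⟩
  · rcases le_or_gt x (1 - 2 * D.a) with h2 | h2
    · exact D.linearIndependent_mid ⟨h1.le, h2⟩
    · exact D.linearIndependent_right ⟨h2.le, hx.2⟩

/-! ### The good strip about the core -/

/-- **The forbidden set** in `ℝ⁴`: the two knots and `avoid`. [folklore] -/
def forbidden (_D : CoreData K₁ K₂ avoid) : Set (𝔼 4) := Subtype.val '' (range K₁ ∪ range K₂ ∪ avoid)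

/-- The forbidden set is closed. [folklore] -/
theorem isClosed_forbidden : IsClosed (D.forbidden) :=
  (Metric.isClosed_sphere.isClosedEmbedding_subtypeVal).isClosedMap _
    ((K₁.isClosed_range.union K₂.isClosed_range).union D.isClosed_avoid)

/-- `x = 2k` with `k : ℤ` is impossible for `x ∈ (0, 1)`; likewise `x = 1 + 2k`. [folklore] -/
theorem circlePoint_pi_mul_ne {x : ℝ} (hx : x ∈ Ioo (0 : ℝ) 1) :
    circlePoint (π * x) ≠ circlePoint 0 ∧ circlePoint (π * x) ≠ circlePoint π := by
  constructor
  · intro h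
    obtain ⟨k, hk⟩ := exists_eq_add_of_circlePoint_eq h
    have hk' : x = 2 * k := by
      have h2 : π * x = π * (2 * k) := by rw [hk]; ring
      exact mul_left_cancel₀ Real.pi_pos.ne' h2
    have h1 : (0 : ℝ) < k := by have := hx.1; rw [hk'] at this; linarith
    have h2 : (k : ℝ) < 1 := by have := hx.2; rw [hk'] at this; linarith
    have h3 : (0 : ℤ) < k := by exact_mod_cast h1
    have h4 : k < (1 : ℤ) := by exact_mod_cast h2
    omega
  · intro h
    obtain ⟨k, hk⟩ := exists_eq_add_of_circlePoint_eq h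
    have hk' : x = 1 + 2 * k := by
      have h2 : π * x = π * (1 + 2 * k) := by rw [hk]; ring
      exact mul_left_cancel₀ Real.pi_pos.ne' h2
    have h1 : (-1 : ℝ) < 2 * k := by have := hx.1; rw [hk'] at this; linarith
    have h2 : (2 * k : ℝ) < 0 := by have := hx.2; rw [hk'] at this; linarith
    have h3 : (-1 : ℤ) < 2 * k := by exact_mod_cast h1
    have h4 : 2 * k < (0 : ℤ) := by exact_mod_cast h2
    omega

/-- **The middle of the core is off the forbidden set**: for `a ≤ x₀ ≤ 1 - a` the core point
`e (circlePoint (πx₀))` is not on `K₁` (that happens only at the angle `0`), not on `K₂` (only at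
the angle `π`), and not in `avoid`. [folklore] -/
theorem core_not_mem_forbidden {x : ℝ} (hx : x ∈ Icc D.a (1 - D.a)) : D.core x ∉ D.forbidden := by
  have ha := D.a_pos
  have hx' : x ∈ Ioo (0 : ℝ) 1 := ⟨by linarith [hx.1], by linarith [hx.2]⟩
  obtain ⟨hne0, hneπ⟩ := circlePoint_pi_mul_ne hx'
  rw [D.core_eq]
  rintro ⟨y, hy, hye⟩
  have hy' : y = D.e (circlePoint (π * x)) := Subtype.val_injective hye
  subst hy'
  rcases hy with (hy | hy) | hy
  · exact hne0 (D.e_mem_left _ hy)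
  · exact hneπ (D.e_mem_right _ hy)
  · exact D.e_not_mem _ hy

/-- The frame `(A, ∂₀ A, ∂_s A)` depends continuously on the point. [folklore] -/
theorem continuous_frame : Continuous fun p : ℝ × ℝ ↦
    (![D.A p, fderiv ℝ D.A p (1, 0), fderiv ℝ D.A p (0, 1)] : Fin 3 → 𝔼 4) := by
  have hc : Continuous (fderiv ℝ D.A) := D.contDiff_A.continuous_fderiv (by simp)
  refine continuous_pi fun i ↦ ?_
  fin_cases i
  · simpa using D.contDiff_A.continuous
  · simpa using hc.clm_apply continuous_const
  · simpa using hc.clm_apply continuous_const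

/-- The set of points where the frame is linearly independent is open. [folklore] -/
theorem isOpen_setOf_linearIndependent_frame : IsOpen {p : ℝ × ℝ |
    LinearIndependent ℝ ![D.A p, fderiv ℝ D.A p (1, 0), fderiv ℝ D.A p (0, 1)]} :=
  isOpen_setOf_linearIndependent.preimage D.continuous_frame

/-- The set of points where `A ≠ 0` and `A/‖A‖` is off the forbidden set is open. [folklore] -/
theorem isOpen_setOf_off : IsOpen {p : ℝ × ℝ | D.A p ≠ 0 ∧ ‖D.A p‖⁻¹ • D.A p ∉ D.forbidden} := by
  have h1 : IsOpen {p : ℝ × ℝ | D.A p ≠ 0} := isOpen_ne_fun D.contDiff_A.continuous continuous_const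
  have h2 : ContinuousOn (fun p : ℝ × ℝ ↦ ‖D.A p‖⁻¹ • D.A p) {p : ℝ × ℝ | D.A p ≠ 0} := by
    intro p hp
    have hc : ContinuousAt (fun q : ℝ × ℝ ↦ ‖D.A q‖⁻¹ • D.A q) p :=
      ((D.contDiff_A.continuous.continuousAt.norm).inv₀ (norm_ne_zero_iff.2 hp)).smul
        D.contDiff_A.continuous.continuousAt
    exact hc.continuousWithinAt
  exact h2.isOpen_inter_preimage h1 D.isClosed_forbidden.isOpen_compl

/-- **The good strip.**  For some `η > 0`: at every point of `[-2a, 1 + 2a] × (-η, η)` the frame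
`(A, ∂₀ A, ∂_s A)` is linearly independent (so `A ≠ 0` and `A/‖A‖` is an immersion there), and
over `[a, 1 - a]` the point `A/‖A‖` is off `K₁ ∪ K₂ ∪ avoid`. [folklore] -/
theorem exists_good_strip : ∃ η > 0, ∀ x ∈ Icc (-(2 * D.a)) (1 + 2 * D.a), ∀ s ∈ Ioo (-η) η,
    LinearIndependent ℝ ![D.A (x, s), fderiv ℝ D.A (x, s) (1, 0), fderiv ℝ D.A (x, s) (0, 1)] ∧
    (x ∈ Icc D.a (1 - D.a) → D.A (x, s) ≠ 0 ∧ ‖D.A (x, s)‖⁻¹ • D.A (x, s) ∉ D.forbidden) := by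
  have h2ζ := D.two_a_lt_ζ
  have hopen : IsOpen {p : ℝ × ℝ |
      LinearIndependent ℝ ![D.A p, fderiv ℝ D.A p (1, 0), fderiv ℝ D.A p (0, 1)] ∧
      (p.1 ∈ Icc D.a (1 - D.a) → D.A p ≠ 0 ∧ ‖D.A p‖⁻¹ • D.A p ∉ D.forbidden)} := by
    have h3 : IsOpen {p : ℝ × ℝ | p.1 ∉ Icc D.a (1 - D.a) ∨
        (D.A p ≠ 0 ∧ ‖D.A p‖⁻¹ • D.A p ∉ D.forbidden)} :=
      (isClosed_Icc.preimage continuous_fst).isOpen_compl.union D.isOpen_setOf_off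
    convert D.isOpen_setOf_linearIndependent_frame.inter h3 using 1
    ext p
    simp only [mem_setOf_eq, mem_inter_iff, or_iff_not_imp_left, not_not]
  have hcore : ∀ x ∈ Icc (-(2 * D.a)) (1 + 2 * D.a),
      LinearIndependent ℝ ![D.A (x, 0), fderiv ℝ D.A (x, 0) (1, 0), fderiv ℝ D.A (x, 0) (0, 1)] ∧
      ((x, (0 : ℝ)).1 ∈ Icc D.a (1 - D.a) → D.A (x, 0) ≠ 0 ∧ ‖D.A (x, 0)‖⁻¹ • D.A (x, 0) ∉ D.forbidden) := by
    intro x hx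
    refine ⟨D.linearIndependent_core hx, fun hx' ↦ ?_⟩
    have hxo : x ∈ Ioo (-D.ζ) (1 + D.ζ) := ⟨by linarith [hx.1], by linarith [hx.2]⟩
    rw [D.A_zero hxo, D.norm_core, inv_one, one_smul]
    exact ⟨fun h0 ↦ by simpa [h0] using D.norm_core x, D.core_not_mem_forbidden hx'⟩
  obtain ⟨η, hη, hgood⟩ := exists_pos_forall_Icc_of_isOpen hopen hcore
  exact ⟨η, hη, fun x hx s hs ↦ hgood x hx s hs⟩

/-- The differential of `A` on a vector of `ℝ²`, in terms of the two partial derivatives.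
[folklore] -/
theorem fderiv_A_apply (p : ℝ × ℝ) (v : ℝ × ℝ) :
    fderiv ℝ D.A p v = v.1 • fderiv ℝ D.A p (1, 0) + v.2 • fderiv ℝ D.A p (0, 1) := by
  conv_lhs => rw [show v = v.1 • ((1 : ℝ), (0 : ℝ)) + v.2 • ((0 : ℝ), (1 : ℝ)) by ext <;> simp]
  rw [map_add, map_smul, map_smul]

/-- From linear independence of `(A, ∂₀ A, ∂_s A)` to the transversality hypothesis of
`injective_fderiv_normalize`. [folklore] -/
theorem eq_zero_of_frame {u₀ u₁ u₂ : 𝔼 4} (h : LinearIndependent ℝ ![u₀, u₁, u₂]) {v : ℝ × ℝ}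
    {μ : ℝ} (hv : v.1 • u₁ + v.2 • u₂ = μ • u₀) : v = 0 := by
  rw [Fintype.linearIndependent_iff] at h
  have h0 := h ![-μ, v.1, v.2] (by
    rw [Fin.sum_univ_three]
    simp only [Matrix.cons_val_zero, Matrix.cons_val_one, Matrix.cons_val]
    rw [neg_smul, ← hv]; abel)
  have h1 := h0 1
  have h2 := h0 2
  simp at h1 h2
  ext <;> assumption

/-- **`A/‖A‖` is an immersion where the frame is linearly independent.** [folklore] -/
theorem injective_fderiv_normalize_A {p : ℝ × ℝ}
    (h : LinearIndependent ℝ ![D.A p, fderiv ℝ D.A p (1, 0), fderiv ℝ D.A p (0, 1)]) :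
    Injective (fderiv ℝ (fun q ↦ ‖D.A q‖⁻¹ • D.A q) p) := by
  refine injective_fderiv_normalize (D.differentiable_A p) (h.ne_zero 0) fun v μ hv ↦ ?_
  rw [D.fderiv_A_apply] at hv
  exact eq_zero_of_frame h hv

/-- `A/‖A‖` is `C^∞` at points where `A ≠ 0`. [folklore] -/
theorem contDiffAt_normalize_A {p : ℝ × ℝ} (hp : D.A p ≠ 0) :
    ContDiffAt ℝ ∞ (fun q ↦ ‖D.A q‖⁻¹ • D.A q) p :=
  ((D.contDiff_A.contDiffAt.norm ℝ hp).inv (norm_ne_zero_iff.2 hp)).smul D.contDiff_A.contDiffAt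

/-- **Along the core, `A/‖A‖` is the core knot, hence injective on `[-a, 1 + a]`** (an interval
of angles shorter than a full turn). [folklore] -/
theorem injOn_normalize_A_core :
    InjOn (fun x : ℝ ↦ ‖D.A (x, 0)‖⁻¹ • D.A (x, 0)) (Icc (-D.a) (1 + D.a)) := by
  have h2ζ := D.two_a_lt_ζ
  have ha := D.a_pos
  have hval : ∀ x ∈ Icc (-D.a) (1 + D.a), ‖D.A (x, 0)‖⁻¹ • D.A (x, 0) =
      ((D.e (circlePoint (π * x)) : 𝕊 3) : 𝔼 4) := fun x hx ↦ by
    have hxo : x ∈ Ioo (-D.ζ) (1 + D.ζ) := ⟨by linarith [hx.1], by linarith [hx.2]⟩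
    rw [D.A_zero hxo, D.norm_core, inv_one, one_smul, D.core_eq]
  intro x hx y hy hxy
  have hxy' : ‖D.A (x, 0)‖⁻¹ • D.A (x, 0) = ‖D.A (y, 0)‖⁻¹ • D.A (y, 0) := hxy
  rw [hval x hx, hval y hy] at hxy'
  have h1 := D.e.injective (Subtype.val_injective hxy')
  obtain ⟨k, hk⟩ := exists_eq_add_of_circlePoint_eq h1
  have hk' : x - y = 2 * k := by
    have h2 : π * (x - y) = π * (2 * k) := by rw [mul_sub, hk]; ring
    exact mul_left_cancel₀ Real.pi_pos.ne' h2
  have hal := D.a_le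
  have h1 : (-2 : ℝ) < x - y := by linarith [hx.1, hy.2]
  have h2 : x - y < 2 := by linarith [hx.2, hy.1]
  have h3 : (-2 : ℤ) < 2 * k := by exact_mod_cast (hk' ▸ h1)
  have h4 : 2 * k < (2 : ℤ) := by exact_mod_cast (hk' ▸ h2)
  have hk0 : k = 0 := by omega
  rw [hk0] at hk'
  simp at hk'
  linarith

/-- **A uniform injectivity strip**: for some `ε > 0`, `A/‖A‖` is injective on
`[-a, 1 + a] × (-ε, ε)`. [folklore] -/
theorem exists_injOn_strip : ∃ ε > 0,
    InjOn (fun p : ℝ × ℝ ↦ ‖D.A p‖⁻¹ • D.A p) (Icc (-D.a) (1 + D.a) ×ˢ Ioo (-ε) ε) := by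
  have ha := D.a_pos
  obtain ⟨η, hη, hgood⟩ := D.exists_good_strip
  -- clamp into the good region, to get a globally continuous map
  set cl : ℝ → ℝ := fun x ↦ max (-(2 * D.a)) (min (1 + 2 * D.a) x) with hcl
  set cs : ℝ → ℝ := fun s ↦ max (-(η / 2)) (min (η / 2) s) with hcs
  have hclc : Continuous cl := continuous_const.max (continuous_const.min continuous_id)
  have hcsc : Continuous cs := continuous_const.max (continuous_const.min continuous_id)
  have hclm : ∀ x, cl x ∈ Icc (-(2 * D.a)) (1 + 2 * D.a) := fun x ↦
    ⟨le_max_left _ _, max_le (by linarith) (min_le_left _ _)⟩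
  have hcsm : ∀ s, cs s ∈ Ioo (-η) η := fun s ↦
    ⟨lt_of_lt_of_le (by linarith) (le_max_left _ _), lt_of_le_of_lt (max_le (by linarith)
      (min_le_left _ _)) (by linarith)⟩
  have hclid : ∀ x ∈ Icc (-(2 * D.a)) (1 + 2 * D.a), cl x = x := fun x hx ↦ by
    change max _ (min _ x) = x
    rw [min_eq_right hx.2, max_eq_right hx.1]
  have hcsid : ∀ s ∈ Icc (-(η / 2)) (η / 2), cs s = s := fun s hs ↦ by
    change max _ (min _ s) = s
    rw [min_eq_right hs.2, max_eq_right hs.1]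
  set g : ℝ × ℝ → 𝔼 4 := fun p ↦ ‖D.A (cl p.1, cs p.2)‖⁻¹ • D.A (cl p.1, cs p.2) with hg
  have hne : ∀ p : ℝ × ℝ, D.A (cl p.1, cs p.2) ≠ 0 := fun p ↦
    ((hgood _ (hclm p.1) _ (hcsm p.2)).1).ne_zero 0
  have hgc : Continuous g := by
    have hA : Continuous fun p : ℝ × ℝ ↦ D.A (cl p.1, cs p.2) :=
      D.contDiff_A.continuous.comp ((hclc.comp continuous_fst).prodMk (hcsc.comp continuous_snd))
    exact (hA.norm.inv₀ fun p ↦ norm_ne_zero_iff.2 (hne p)).smul hA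
  -- `g` agrees with `A/‖A‖` near the core
  have hgeq : ∀ p ∈ Icc (-(2 * D.a)) (1 + 2 * D.a) ×ˢ Icc (-(η / 2)) (η / 2),
      g p = ‖D.A p‖⁻¹ • D.A p := fun p hp ↦ by
    change ‖D.A (cl p.1, cs p.2)‖⁻¹ • D.A (cl p.1, cs p.2) = _
    rw [hclid p.1 hp.1, hcsid p.2 hp.2]
  have h0 : InjOn (fun x ↦ g (x, 0)) (Icc (-D.a) (1 + D.a)) := by
    intro x hx y hy hxy
    have hx' : ((x, (0 : ℝ)) : ℝ × ℝ) ∈ Icc (-(2 * D.a)) (1 + 2 * D.a) ×ˢ Icc (-(η / 2)) (η / 2) :=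
      ⟨⟨by linarith [hx.1], by linarith [hx.2]⟩, ⟨by linarith, by linarith⟩⟩
    have hy' : ((y, (0 : ℝ)) : ℝ × ℝ) ∈ Icc (-(2 * D.a)) (1 + 2 * D.a) ×ˢ Icc (-(η / 2)) (η / 2) :=
      ⟨⟨by linarith [hy.1], by linarith [hy.2]⟩, ⟨by linarith, by linarith⟩⟩
    simp only [hgeq _ hx', hgeq _ hy'] at hxy
    exact D.injOn_normalize_A_core hx hy hxy
  have hloc : ∀ x ∈ Icc (-D.a) (1 + D.a), ∃ U ∈ 𝓝 (x, (0 : ℝ)), InjOn g U := by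
    intro x hx
    have hx2 : x ∈ Icc (-(2 * D.a)) (1 + 2 * D.a) := ⟨by linarith [hx.1], by linarith [hx.2]⟩
    have hli := (hgood x hx2 0 ⟨by linarith, by linarith⟩).1
    have hA0 : D.A (x, 0) ≠ 0 := hli.ne_zero 0
    obtain ⟨U, hU, hinj⟩ := exists_nhds_injOn_of_injective_fderiv
      ((D.contDiffAt_normalize_A hA0).hasStrictFDerivAt (by simp))
      (D.injective_fderiv_normalize_A hli)
    -- the region where `g = A/‖A‖` is a neighbourhood of `(x, 0)`
    have hV : Ioo (-(2 * D.a)) (1 + 2 * D.a) ×ˢ Ioo (-(η / 2)) (η / 2) ∈ 𝓝 ((x, (0 : ℝ)) : ℝ × ℝ) :=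
      (isOpen_Ioo.prod isOpen_Ioo).mem_nhds ⟨⟨by linarith [hx.1], by linarith [hx.2]⟩,
        ⟨by linarith, by linarith⟩⟩
    refine ⟨U ∩ Ioo (-(2 * D.a)) (1 + 2 * D.a) ×ˢ Ioo (-(η / 2)) (η / 2), inter_mem hU hV,
      fun p hp q hq hpq ↦ hinj hp.1 hq.1 ?_⟩
    rwa [hgeq p ⟨Ioo_subset_Icc_self hp.2.1, Ioo_subset_Icc_self hp.2.2⟩,
      hgeq q ⟨Ioo_subset_Icc_self hq.2.1, Ioo_subset_Icc_self hq.2.2⟩] at hpq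
  obtain ⟨ε, hε, hinj⟩ := exists_injOn_prod_ball_of_isCompact hgc isCompact_Icc h0 hloc
  refine ⟨min ε (η / 2), lt_min hε (by linarith), fun p hp q hq hpq ↦ ?_⟩
  have hp' : p ∈ Icc (-D.a) (1 + D.a) ×ˢ ball (0 : ℝ) ε :=
    ⟨hp.1, by rw [mem_ball_zero_iff, Real.norm_eq_abs, abs_lt]; exact ⟨by
      linarith [hp.2.1, min_le_left ε (η / 2)], by linarith [hp.2.2, min_le_left ε (η / 2)]⟩⟩
  have hq' : q ∈ Icc (-D.a) (1 + D.a) ×ˢ ball (0 : ℝ) ε :=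
    ⟨hq.1, by rw [mem_ball_zero_iff, Real.norm_eq_abs, abs_lt]; exact ⟨by
      linarith [hq.2.1, min_le_left ε (η / 2)], by linarith [hq.2.2, min_le_left ε (η / 2)]⟩⟩
  refine hinj hp' hq' ?_
  rw [hgeq p ⟨⟨by linarith [hp.1.1], by linarith [hp.1.2]⟩, ⟨by linarith [hp.2.1, min_le_right ε (η / 2)],
      by linarith [hp.2.2, min_le_right ε (η / 2)]⟩⟩,
    hgeq q ⟨⟨by linarith [hq.1.1], by linarith [hq.1.2]⟩, ⟨by linarith [hq.2.1, min_le_right ε (η / 2)],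
      by linarith [hq.2.2, min_le_right ε (η / 2)]⟩⟩]
  exact hpq

/-! ### The width of the band and the collar reparametrisation -/

/-- **The width** of the band: a half-width `τ > 0` of a strip about the core on which the frame is
linearly independent over `[-2a, 1 + 2a]`, `A/‖A‖` is off the forbidden set over `[a, 1 - a]`,
and `A/‖A‖` is injective over `[-a, 1 + a]`. [folklore] -/
theorem exists_width : ∃ τ > 0,
    (∀ x ∈ Icc (-(2 * D.a)) (1 + 2 * D.a), ∀ s ∈ Ioo (-τ) τ,
      LinearIndependent ℝ ![D.A (x, s), fderiv ℝ D.A (x, s) (1, 0), fderiv ℝ D.A (x, s) (0, 1)] ∧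
      (x ∈ Icc D.a (1 - D.a) → D.A (x, s) ≠ 0 ∧ ‖D.A (x, s)‖⁻¹ • D.A (x, s) ∉ D.forbidden)) ∧
    InjOn (fun p : ℝ × ℝ ↦ ‖D.A p‖⁻¹ • D.A p) (Icc (-D.a) (1 + D.a) ×ˢ Ioo (-τ) τ) := by
  obtain ⟨η, hη, hgood⟩ := D.exists_good_strip
  obtain ⟨ε, hε, hinj⟩ := D.exists_injOn_strip
  refine ⟨min η ε, lt_min hη hε, fun x hx s hs ↦ hgood x hx s ⟨?_, ?_⟩, hinj.mono (prod_mono le_rfl ?_)⟩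
  · exact lt_of_le_of_lt (by linarith [min_le_left η ε]) hs.1
  · exact lt_of_lt_of_le hs.2 (min_le_left η ε)
  · exact Ioo_subset_Ioo (by linarith [min_le_right η ε]) (min_le_right η ε)

/-- The width of the band (a choice from `exists_width`). [folklore] -/
def τ : ℝ := D.exists_width.choose

/-- `τ > 0`. [folklore] -/
theorem τ_pos : 0 < D.τ := D.exists_width.choose_spec.1

/-- On the strip of half-width `τ` the frame is linearly independent and, over the middle,
`A/‖A‖` is off the forbidden set. [folklore] -/
theorem τ_good {x : ℝ} (hx : x ∈ Icc (-(2 * D.a)) (1 + 2 * D.a)) {s : ℝ} (hs : s ∈ Ioo (-D.τ) D.τ) :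
    LinearIndependent ℝ ![D.A (x, s), fderiv ℝ D.A (x, s) (1, 0), fderiv ℝ D.A (x, s) (0, 1)] ∧
      (x ∈ Icc D.a (1 - D.a) → D.A (x, s) ≠ 0 ∧ ‖D.A (x, s)‖⁻¹ • D.A (x, s) ∉ D.forbidden) :=
  D.exists_width.choose_spec.2.1 x hx s hs

/-- On the strip of half-width `τ` over `[-a, 1 + a]`, `A/‖A‖` is injective. [folklore] -/
theorem τ_injOn : InjOn (fun p : ℝ × ℝ ↦ ‖D.A p‖⁻¹ • D.A p) (Icc (-D.a) (1 + D.a) ×ˢ Ioo (-D.τ) D.τ) :=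
  D.exists_width.choose_spec.2.2

/-- **The collar reparametrisation** `sc x₁ = (τ/2) arctan (x₁ - 1/2)`: the collar coordinate
`x₁ ∈ ℝ` of `BandData` as a coordinate `s ∈ (-τ, τ)` across the strip, vanishing at `x₁ = 1/2`.
[folklore] -/
def sc (t : ℝ) : ℝ := D.τ / 2 * Real.arctan (t - 1 / 2)

/-- `sc` takes values in `(-τ, τ)`. [folklore] -/
theorem sc_mem (t : ℝ) : D.sc t ∈ Ioo (-D.τ) D.τ := by
  have h1 := Real.arctan_lt_pi_div_two (t - 1 / 2)
  have h2 := Real.neg_pi_div_two_lt_arctan (t - 1 / 2)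
  have hτ := D.τ_pos
  have hπ := Real.pi_lt_four
  unfold sc
  constructor <;> nlinarith

/-- `sc (1/2) = 0`. [folklore] -/
theorem sc_half : D.sc (1 / 2) = 0 := by simp [sc]

/-- The derivative of `sc`. [folklore] -/
theorem hasDerivAt_sc (t : ℝ) : HasDerivAt D.sc (D.τ / 2 * (1 / (1 + (t - 1 / 2) ^ 2))) t := by
  unfold sc
  have h := ((Real.hasDerivAt_arctan (t - 1 / 2)).comp t ((hasDerivAt_id t).sub_const (1 / 2)))
  simpa using h.const_mul (D.τ / 2)

/-- `sc' > 0`. [folklore] -/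
theorem deriv_sc_pos (t : ℝ) : 0 < deriv D.sc t := by
  rw [(D.hasDerivAt_sc t).deriv]
  have := D.τ_pos
  positivity

/-- `sc` is injective. [folklore] -/
theorem sc_injective : Injective D.sc := fun s t h ↦ by
  unfold sc at h
  have h' := mul_left_cancel₀ (by have := D.τ_pos; positivity) h
  simpa using Real.arctan_injective h'

/-- `sc` is `C^∞`. [folklore] -/
theorem contDiff_sc : ContDiff ℝ ∞ D.sc :=
  contDiff_const.mul (Real.contDiff_arctan.comp (contDiff_id.sub contDiff_const))

/-! ### The band -/

/-- **The band in `ℝ⁴`** (before normalisation): `B x = A (x₀, sc x₁)`. [folklore] -/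
def B (x : 𝔼 2) : 𝔼 4 := D.A (x 0, D.sc (x 1))

/-- The coordinate map `x ↦ (x₀, sc x₁)`. [folklore] -/
def L (x : 𝔼 2) : ℝ × ℝ := (x 0, D.sc (x 1))

/-- `B = A ∘ L`. [folklore] -/
theorem B_eq_comp : D.B = D.A ∘ D.L := rfl

/-- `L` is `C^∞`. [folklore] -/
theorem contDiff_L : ContDiff ℝ ∞ D.L := by
  unfold L
  exact (contDiff_euclidean.1 contDiff_id 0).prodMk (D.contDiff_sc.comp (contDiff_euclidean.1 contDiff_id 1))

/-- `B` is `C^∞`. [folklore] -/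
theorem contDiff_B : ContDiff ℝ ∞ D.B := D.contDiff_A.comp D.contDiff_L

/-- **`B` never vanishes**: on the two end zones it is a point of a tube (unit norm), in between
the frame is linearly independent. [folklore] -/
theorem B_ne_zero (x : 𝔼 2) : D.B x ≠ 0 := by
  unfold B
  rcases le_or_gt (x 0) D.a with h1 | h1
  · rw [D.A_eq_P₁ (p := (x 0, D.sc (x 1))) h1, ← norm_ne_zero_iff, D.norm_P₁]; exact one_ne_zero
  · rcases le_or_gt (1 - D.a) (x 0) with h2 | h2
    · rw [D.A_eq_P₂ (p := (x 0, D.sc (x 1))) h2, ← norm_ne_zero_iff, D.norm_P₂]; exact one_ne_zero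
    · have ha := D.a_pos
      exact (D.τ_good ⟨by linarith, by linarith⟩ (D.sc_mem (x 1))).1.ne_zero 0

/-- **The band** `𝔼 2 → 𝕊 3`: the normalisation of `B`. [folklore] -/
def band : 𝔼 2 → 𝕊 3 :=
  Set.codRestrict (fun x ↦ ‖D.B x‖⁻¹ • D.B x) _ fun x ↦ by
    rw [mem_sphere_zero_iff_norm, norm_smul, norm_inv, norm_norm,
      inv_mul_cancel₀ (norm_ne_zero_iff.2 (D.B_ne_zero x))]

/-- The band in `ℝ⁴`. [folklore] -/
theorem coe_band (x : 𝔼 2) : ((D.band x : 𝕊 3) : 𝔼 4) = ‖D.B x‖⁻¹ • D.B x := rfl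

/-- The normalised band is `C^∞` into `ℝ⁴`. [folklore] -/
theorem contDiff_coe_band : ContDiff ℝ ∞ fun x ↦ ((D.band x : 𝕊 3) : 𝔼 4) := by
  rw [contDiff_iff_contDiffAt]
  intro x
  exact ((D.contDiff_B.contDiffAt.norm ℝ (D.B_ne_zero x)).inv
    (norm_ne_zero_iff.2 (D.B_ne_zero x))).smul D.contDiff_B.contDiffAt

/-- **The band is `C^∞`** as a map into `S³`. [folklore] -/
theorem contMDiff_band : ContMDiff 𝓘(ℝ, 𝔼 2) (𝓡 3) ∞ D.band :=
  D.contDiff_coe_band.contMDiff.codRestrict_sphere _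

/-- **The band on the left zone is the flat strip of `ν₁`**:
`band x = ν₁ (circlePoint (sc x₁), (κπx₀) e₀)` for `x₀ ≤ a`. [folklore] -/
theorem band_eq_left {x : 𝔼 2} (hx : x 0 ≤ D.a) :
    D.band x = D.ν₁ (circlePoint (D.sc (x 1)), (D.κ * π * x 0) • (EuclideanSpace.single 0 1 : 𝔼 2)) := by
  apply Subtype.ext
  rw [D.coe_band]
  unfold B
  rw [D.A_eq_P₁ (p := (x 0, D.sc (x 1))) hx, D.norm_P₁, inv_one, one_smul]
  rfl

/-- **The band on the right zone is the flat strip of `ν₂`**: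
`band x = ν₂ (circlePoint (-sc x₁), (κπ(x₀ - 1)) e₀)` for `1 - a ≤ x₀`. [folklore] -/
theorem band_eq_right {x : 𝔼 2} (hx : 1 - D.a ≤ x 0) :
    D.band x = D.ν₂ (circlePoint (-D.sc (x 1)), (D.κ * π * (x 0 - 1)) • (EuclideanSpace.single 0 1 : 𝔼 2)) := by
  apply Subtype.ext
  rw [D.coe_band]
  unfold B
  rw [D.A_eq_P₂ (p := (x 0, D.sc (x 1))) hx, D.norm_P₂, inv_one, one_smul]
  rfl

/-- **The band over the middle is off `K₁ ∪ K₂ ∪ avoid`** (`a ≤ x₀ ≤ 1 - a`). [folklore] -/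
theorem coe_band_not_mem {x : 𝔼 2} (hx : x 0 ∈ Icc D.a (1 - D.a)) :
    ((D.band x : 𝕊 3) : 𝔼 4) ∉ D.forbidden := by
  have ha := D.a_pos
  exact ((D.τ_good ⟨by linarith [hx.1], by linarith [hx.2]⟩ (D.sc_mem (x 1))).2 hx).2

/-- The fibre coordinate of the end strips is within the tube radius on the square:
`|κπx₀| ≤ r` for `|x₀| ≤ a` (indeed `κπa = rh/8`). [folklore] -/
theorem norm_fibre_le {y : ℝ} (hy : |y| ≤ D.a) : ‖(D.κ * π * y) • (EuclideanSpace.single 0 1 : 𝔼 2)‖ ≤ D.r := by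
  rw [norm_smul, Knot.TubularNbhd.norm_single_zero_one, mul_one, Real.norm_eq_abs, abs_mul,
    abs_of_pos (mul_pos D.κ_pos Real.pi_pos)]
  have h1 : D.κ * π * |y| ≤ D.κ * π * D.a :=
    mul_le_mul_of_nonneg_left hy (mul_pos D.κ_pos Real.pi_pos).le
  have h2 : D.κ * π * D.a = D.r * D.h / 8 := by
    unfold a; rw [← D.pi_mul_ζ]; unfold κ; ring
  have h3 := D.h_le
  have h4 := D.r_pos
  nlinarith

/-! ### Derivatives of the band along the collar lines -/

/-- The vertical line `t ↦ (c, t)` of the square has velocity `(0, 1)`. [folklore] -/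
theorem hasDerivAt_pt2_snd (c t : ℝ) : HasDerivAt (fun t : ℝ ↦ pt2 c t) (pt2 0 1) t := by
  have h : (fun t : ℝ ↦ pt2 c t) = fun t ↦ pt2 c 0 + t • pt2 0 1 := by
    funext t
    ext i
    fin_cases i <;> simp [pt2]
  rw [h]
  simpa using ((hasDerivAt_id t).smul_const (pt2 0 1)).const_add (pt2 c 0)

/-- `pt2 0 (-1) = -pt2 0 1`. [folklore] -/
theorem pt2_zero_neg_one : pt2 0 (-1) = -pt2 0 1 := by
  ext i; fin_cases i <;> simp [pt2]

/-- The ambient velocity curve of a knot, `θ ↦ K (circlePoint θ) ∈ ℝ⁴`, is `C^∞`. [folklore] -/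
theorem contDiff_coe_knot_circlePoint (K : Knot) :
    ContDiff ℝ ∞ fun θ : ℝ ↦ ((K (circlePoint θ) : 𝕊 3) : 𝔼 4) :=
  contMDiff_iff_contDiff.1 (contMDiff_coe_sphere.comp (K.contMDiff.comp contMDiff_circlePoint))

/-- **The band along the left edge line is `K₁` reparametrised by `sc`**:
`band (0, t) = K₁ (circlePoint (sc t))`. [folklore] -/
theorem coe_band_pt2_zero (t : ℝ) :
    ((D.band (pt2 0 t) : 𝕊 3) : 𝔼 4) = ((K₁ (circlePoint (D.sc t)) : 𝕊 3) : 𝔼 4) := by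
  rw [D.band_eq_left (x := pt2 0 t) (by rw [pt2_apply_zero]; exact D.a_pos.le)]
  rw [pt2_apply_zero, pt2_apply_one, mul_zero, zero_smul, D.ν₁.coe_apply_zero]

/-- **The band along the right edge line is `K₂` reparametrised by `-sc`**:
`band (1, t) = K₂ (circlePoint (-sc t))`. [folklore] -/
theorem coe_band_pt2_one (t : ℝ) :
    ((D.band (pt2 1 t) : 𝕊 3) : 𝔼 4) = ((K₂ (circlePoint (-D.sc t)) : 𝕊 3) : 𝔼 4) := by
  rw [D.band_eq_right (x := pt2 1 t) (by rw [pt2_apply_zero]; linarith [D.a_pos])]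
  rw [pt2_apply_zero, pt2_apply_one, sub_self, mul_zero, zero_smul, D.ν₂.coe_apply_zero]

/-- The directional derivative of the band along a vertical line of the square. [folklore] -/
theorem fderiv_coe_band_pt2 (c t : ℝ) :
    fderiv ℝ (fun x ↦ ((D.band x : 𝕊 3) : 𝔼 4)) (pt2 c t) (pt2 0 1) =
      deriv (fun s : ℝ ↦ ((D.band (pt2 c s) : 𝕊 3) : 𝔼 4)) t := by
  have hF : HasFDerivAt (fun x ↦ ((D.band x : 𝕊 3) : 𝔼 4))
      (fderiv ℝ (fun x ↦ ((D.band x : 𝕊 3) : 𝔼 4)) (pt2 c t)) (pt2 c t) :=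
    ((D.contDiff_coe_band.differentiable (by simp)) _).hasFDerivAt
  exact (hF.comp_hasDerivAt t (hasDerivAt_pt2_snd c t)).deriv.symm

/-- **Orientation on the left edge**: `K₁` traverses the left edge line upwards — the velocity
of `K₁` at `K₁ (1, 0) = band (0, 1/2)` is the positive multiple `(sc' (1/2))⁻¹` of
`∂band/∂x₁`. [folklore] -/
theorem orient_left : ∃ θ c : ℝ, 0 < c ∧ K₁ (circlePoint θ) = D.band (pt2 0 2⁻¹) ∧
    deriv (fun t ↦ ((K₁ (circlePoint t) : 𝕊 3) : 𝔼 4)) θ =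
      c • fderiv ℝ (fun x ↦ ((D.band x : 𝕊 3) : 𝔼 4)) (pt2 0 2⁻¹) (pt2 0 1) := by
  have hd := D.deriv_sc_pos (1 / 2)
  refine ⟨0, (deriv D.sc (1 / 2))⁻¹, inv_pos.2 hd, ?_, ?_⟩
  · apply Subtype.ext
    rw [show (2⁻¹ : ℝ) = 1 / 2 by norm_num, D.coe_band_pt2_zero, D.sc_half]
  · rw [show (2⁻¹ : ℝ) = 1 / 2 by norm_num, D.fderiv_coe_band_pt2]
    have hfun : (fun s : ℝ ↦ ((D.band (pt2 0 s) : 𝕊 3) : 𝔼 4)) =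
        (fun θ : ℝ ↦ ((K₁ (circlePoint θ) : 𝕊 3) : 𝔼 4)) ∘ D.sc := by
      funext s; exact D.coe_band_pt2_zero s
    have hg : HasDerivAt (fun θ : ℝ ↦ ((K₁ (circlePoint θ) : 𝕊 3) : 𝔼 4))
        (deriv (fun θ : ℝ ↦ ((K₁ (circlePoint θ) : 𝕊 3) : 𝔼 4)) 0) (D.sc (1 / 2)) := by
      rw [D.sc_half]
      exact (((contDiff_coe_knot_circlePoint K₁).differentiable (by simp)) _).hasDerivAt
    rw [hfun, (hg.scomp (1 / 2) (D.hasDerivAt_sc (1 / 2))).deriv, smul_smul,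
      ← (D.hasDerivAt_sc (1 / 2)).deriv, inv_mul_cancel₀ hd.ne', one_smul]

/-- **Orientation on the right edge**: `K₂` traverses the right edge line downwards. [folklore] -/
theorem orient_right : ∃ θ c : ℝ, 0 < c ∧ K₂ (circlePoint θ) = D.band (pt2 1 2⁻¹) ∧
    deriv (fun t ↦ ((K₂ (circlePoint t) : 𝕊 3) : 𝔼 4)) θ =
      c • fderiv ℝ (fun x ↦ ((D.band x : 𝕊 3) : 𝔼 4)) (pt2 1 2⁻¹) (pt2 0 (-1)) := by
  have hd := D.deriv_sc_pos (1 / 2)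
  refine ⟨0, (deriv D.sc (1 / 2))⁻¹, inv_pos.2 hd, ?_, ?_⟩
  · apply Subtype.ext
    rw [show (2⁻¹ : ℝ) = 1 / 2 by norm_num, D.coe_band_pt2_one, D.sc_half, neg_zero]
  · rw [show (2⁻¹ : ℝ) = 1 / 2 by norm_num, pt2_zero_neg_one, map_neg, D.fderiv_coe_band_pt2]
    have hfun : (fun s : ℝ ↦ ((D.band (pt2 1 s) : 𝕊 3) : 𝔼 4)) =
        (fun θ : ℝ ↦ ((K₂ (circlePoint θ) : 𝕊 3) : 𝔼 4)) ∘ (-D.sc) := by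
      funext s; exact D.coe_band_pt2_one s
    have hg : HasDerivAt (fun θ : ℝ ↦ ((K₂ (circlePoint θ) : 𝕊 3) : 𝔼 4))
        (deriv (fun θ : ℝ ↦ ((K₂ (circlePoint θ) : 𝕊 3) : 𝔼 4)) 0) (-D.sc (1 / 2)) := by
      rw [D.sc_half, neg_zero]
      exact (((contDiff_coe_knot_circlePoint K₂).differentiable (by simp)) _).hasDerivAt
    rw [hfun, (hg.scomp (1 / 2) (D.hasDerivAt_sc (1 / 2)).neg).deriv, neg_smul, neg_neg, smul_smul,
      ← (D.hasDerivAt_sc (1 / 2)).deriv, inv_mul_cancel₀ hd.ne', one_smul]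

/-! ### The band as pre-band data -/

/-- The differential of the coordinate map `L x = (x₀, sc x₁)`. [folklore] -/
theorem hasFDerivAt_L (x : 𝔼 2) : HasFDerivAt D.L
    ((EuclideanSpace.proj (0 : Fin 2) : 𝔼 2 →L[ℝ] ℝ).prod
      (deriv D.sc (x 1) • (EuclideanSpace.proj (1 : Fin 2) : 𝔼 2 →L[ℝ] ℝ))) x := by
  have hL : D.L = fun y : 𝔼 2 ↦ ((y 0, D.sc (y 1)) : ℝ × ℝ) := rfl
  rw [hL]
  refine (EuclideanSpace.proj (0 : Fin 2) : 𝔼 2 →L[ℝ] ℝ).hasFDerivAt.prodMk ?_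
  have hsc : HasDerivAt D.sc (deriv D.sc (x 1)) (x 1) := by
    rw [(D.hasDerivAt_sc (x 1)).deriv]; exact D.hasDerivAt_sc (x 1)
  have h := hsc.comp_hasFDerivAt x (EuclideanSpace.proj (1 : Fin 2) : 𝔼 2 →L[ℝ] ℝ).hasFDerivAt
  exact h

/-- Ambient versus intrinsic differential for maps into the sphere (chain rule with the
inclusion, as in `FlatteningChart.lean`). [folklore] -/
theorem injective_mfderiv_of_injective_fderiv_coe' {β : 𝔼 2 → 𝕊 3}
    (hβ : ContMDiff 𝓘(ℝ, 𝔼 2) (𝓡 3) ∞ β) {x : 𝔼 2}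
    (hx : Injective (fderiv ℝ (fun y ↦ ((β y : 𝕊 3) : 𝔼 4)) x)) :
    Injective (mfderiv 𝓘(ℝ, 𝔼 2) (𝓡 3) β x) := by
  have hn : (∞ : WithTop ℕ∞) ≠ 0 := by simp
  have hcomp : fderiv ℝ (fun y ↦ ((β y : 𝕊 3) : 𝔼 4)) x =
      (mfderiv (𝓡 3) 𝓘(ℝ, 𝔼 4) (Subtype.val : 𝕊 3 → 𝔼 4) (β x)).comp
        (mfderiv 𝓘(ℝ, 𝔼 2) (𝓡 3) β x) := by
    rw [← mfderiv_eq_fderiv]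
    exact mfderiv_comp x (contMDiff_coe_sphere.mdifferentiableAt hn) (hβ.mdifferentiableAt hn)
  have hfun : ⇑(fderiv ℝ (fun y ↦ ((β y : 𝕊 3) : 𝔼 4)) x) =
      ⇑(mfderiv (𝓡 3) 𝓘(ℝ, 𝔼 4) (Subtype.val : 𝕊 3 → 𝔼 4) (β x)) ∘
        ⇑(mfderiv 𝓘(ℝ, 𝔼 2) (𝓡 3) β x) := by
    rw [hcomp]; rfl
  rw [hfun] at hx
  exact hx.of_comp

/-- A point of the square has `x₀ ∈ [-a, 1 + a]`, `(x₀, sc x₁)` in the injectivity strip, and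
`|x₀| ≤ a` on the left zone, `|x₀ - 1| ≤ a` on the right zone. [folklore] -/
theorem L_mem_of_mem_squareNhd {x : 𝔼 2} (hx : x ∈ squareNhd D.a) :
    D.L x ∈ Icc (-D.a) (1 + D.a) ×ˢ Ioo (-D.τ) D.τ :=
  ⟨⟨(hx 0).1.le, (hx 0).2.le⟩, D.sc_mem (x 1)⟩

/-- **The band is an immersion on the square.** [folklore] -/
theorem injective_mfderiv_band {x : 𝔼 2} (hx : x ∈ squareNhd D.a) :
    Injective (mfderiv 𝓘(ℝ, 𝔼 2) (𝓡 3) D.band x) := by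
  have ha := D.a_pos
  apply injective_mfderiv_of_injective_fderiv_coe' D.contMDiff_band
  -- `band = (A/‖A‖) ∘ L` in `ℝ⁴`
  have hfun : (fun y ↦ ((D.band y : 𝕊 3) : 𝔼 4)) = (fun p : ℝ × ℝ ↦ ‖D.A p‖⁻¹ • D.A p) ∘ D.L := rfl
  have hB : D.A (D.L x) ≠ 0 := D.B_ne_zero x
  have hli := (D.τ_good (x := x 0) ⟨by linarith [(hx 0).1], by linarith [(hx 0).2]⟩
    (D.sc_mem (x 1))).1
  have hinjA := D.injective_fderiv_normalize_A hli
  rw [hfun, fderiv_comp x ((D.contDiffAt_normalize_A hB).differentiableAt (by simp))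
    (D.hasFDerivAt_L x).differentiableAt, (D.hasFDerivAt_L x).fderiv]
  refine hinjA.comp ?_
  refine (injective_iff_map_eq_zero _).2 fun v hv ↦ ?_
  have h1 : v 0 = 0 := congrArg Prod.fst hv
  have h2 : deriv D.sc (x 1) * v 1 = 0 := congrArg Prod.snd hv
  have h2' : v 1 = 0 := (mul_eq_zero.1 h2).resolve_left (D.deriv_sc_pos (x 1)).ne'
  rw [euclideanSpace_two_decomp v, h1, h2', zero_smul, zero_smul, add_zero]

/-- **The band is injective on the square.** [folklore] -/
theorem injOn_band : InjOn D.band (squareNhd D.a) := by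
  intro x hx y hy hxy
  have h := congrArg (fun z : 𝕊 3 ↦ (z : 𝔼 4)) hxy
  simp only [D.coe_band] at h
  have hL : D.L x = D.L y := D.τ_injOn (D.L_mem_of_mem_squareNhd hx) (D.L_mem_of_mem_squareNhd hy) h
  have h0 : x 0 = y 0 := congrArg Prod.fst hL
  have h1 : x 1 = y 1 := D.sc_injective (congrArg Prod.snd hL)
  ext i
  fin_cases i
  · exact h0
  · exact h1

/-- The three zones of a point of the square: left (`x₀ ≤ a`, where `|x₀| ≤ a`), middle, right
(`1 - a ≤ x₀`, where `|x₀ - 1| ≤ a`). [folklore] -/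
theorem zones {x : 𝔼 2} (hx : x ∈ squareNhd D.a) :
    (x 0 ≤ D.a ∧ |x 0| ≤ D.a) ∨ x 0 ∈ Icc D.a (1 - D.a) ∨ (1 - D.a ≤ x 0 ∧ |x 0 - 1| ≤ D.a) := by
  have h0 := hx 0
  rcases le_or_gt (x 0) D.a with h1 | h1
  · exact Or.inl ⟨h1, abs_le.2 ⟨h0.1.le, h1⟩⟩
  · rcases le_or_gt (1 - D.a) (x 0) with h2 | h2
    · exact Or.inr (Or.inr ⟨h2, abs_le.2 ⟨by linarith, by linarith [h0.2]⟩⟩)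
    · exact Or.inr (Or.inl ⟨h1.le, h2.le⟩)

/-- **The band misses `avoid`.** [folklore] -/
theorem disjoint_band_avoid : Disjoint (D.band '' squareNhd D.a) avoid := by
  rw [Set.disjoint_left]
  rintro _ ⟨x, hx, rfl⟩ hmem
  rcases D.zones hx with ⟨h1, h1'⟩ | h2 | ⟨h3, h3'⟩
  · rw [D.band_eq_left h1] at hmem
    exact (D.tube₁ _ _ (D.norm_fibre_le h1')).1 hmem
  · exact D.coe_band_not_mem h2 ⟨D.band x, Or.inr hmem, rfl⟩
  · rw [D.band_eq_right h3] at hmem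
    exact (D.tube₂ _ _ (D.norm_fibre_le h3')).1 hmem

/-- `κπ ≠ 0`. [folklore] -/
theorem κ_mul_pi_ne_zero : D.κ * π ≠ 0 := mul_ne_zero D.κ_pos.ne' Real.pi_pos.ne'

/-- **`K₁` meets the band exactly in the left edge line `x₀ = 0`.** [folklore] -/
theorem preimage_left : D.band ⁻¹' range K₁ ∩ squareNhd D.a = {x ∈ squareNhd D.a | x 0 = 0} := by
  ext x
  simp only [mem_inter_iff, mem_preimage, mem_setOf_eq]
  constructor
  · rintro ⟨hK, hx⟩
    refine ⟨hx, ?_⟩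
    rcases D.zones hx with ⟨h1, -⟩ | h2 | ⟨h3, h3'⟩
    · rw [D.band_eq_left h1] at hK
      by_contra hne
      refine D.ν₁.apply_mem_compl_range ?_ hK
      rw [smul_ne_zero_iff]
      exact ⟨mul_ne_zero D.κ_mul_pi_ne_zero hne, CoreData.single_ne_zero⟩
    · exact absurd ⟨D.band x, Or.inl (Or.inl hK), rfl⟩ (D.coe_band_not_mem h2)
    · rw [D.band_eq_right h3] at hK
      exact absurd hK (D.tube₂ _ _ (D.norm_fibre_le h3')).2
  · rintro ⟨hx, h0⟩
    refine ⟨?_, hx⟩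
    rw [D.band_eq_left (by rw [h0]; exact D.a_pos.le), h0, mul_zero, zero_smul, D.ν₁.coe_apply_zero]
    exact ⟨_, rfl⟩

/-- **`K₂` meets the band exactly in the right edge line `x₀ = 1`.** [folklore] -/
theorem preimage_right : D.band ⁻¹' range K₂ ∩ squareNhd D.a = {x ∈ squareNhd D.a | x 0 = 1} := by
  ext x
  simp only [mem_inter_iff, mem_preimage, mem_setOf_eq]
  constructor
  · rintro ⟨hK, hx⟩
    refine ⟨hx, ?_⟩
    rcases D.zones hx with ⟨h1, h1'⟩ | h2 | ⟨h3, -⟩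
    · rw [D.band_eq_left h1] at hK
      exact absurd hK (D.tube₁ _ _ (D.norm_fibre_le h1')).2
    · exact absurd ⟨D.band x, Or.inl (Or.inr hK), rfl⟩ (D.coe_band_not_mem h2)
    · rw [D.band_eq_right h3] at hK
      by_contra hne
      refine D.ν₂.apply_mem_compl_range ?_ hK
      rw [smul_ne_zero_iff]
      exact ⟨mul_ne_zero D.κ_mul_pi_ne_zero (sub_ne_zero.2 hne), CoreData.single_ne_zero⟩
  · rintro ⟨hx, h0⟩
    refine ⟨?_, hx⟩
    rw [D.band_eq_right (by rw [h0]; linarith [D.a_pos]), h0, sub_self, mul_zero, zero_smul,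
      D.ν₂.coe_apply_zero]
    exact ⟨_, rfl⟩

/-- **The band from the core data**: pre-band data `K₁`, `K₂`, `avoid` with collar width `a`.
[folklore] -/
def preBandData : PreBandData K₁ K₂ avoid where
  band := D.band
  δ := D.a
  δ_pos := D.a_pos
  contMDiff := D.contMDiff_band
  injOn := D.injOn_band
  injective_mfderiv _ hx := D.injective_mfderiv_band hx
  disjoint_avoid := D.disjoint_band_avoid
  preimage_left := D.preimage_left
  preimage_right := D.preimage_right
  orient_left := D.orient_left
  orient_right := D.orient_right

/-- Core data yield pre-band data. [folklore] -/
theorem nonempty_preBandData (D : CoreData K₁ K₂ avoid) : Nonempty (PreBandData K₁ K₂ avoid) :=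
  ⟨D.preBandData⟩

end CoreData

/-- **Existence of a band** (Gompf–Stipsicz (1999), §5.1: *"a band `b` … connecting `K₁` to
`K₂`, disjoint from the rest of the link"*): if `K₁`, `K₂` are disjoint knots, `avoid` is a closed
set missing both, and some path from `K₁` to `K₂` misses `avoid`, then there are pre-band data
`PreBandData K₁ K₂ avoid` — a smoothly embedded band from `K₁` to `K₂` avoiding `avoid`, meeting
`K₁` exactly in its left edge line (traversed upwards) and `K₂` exactly in its right edge line
(traversed downwards).  Assembled from `exists_coreLoop` (`BandCoreLoop.lean`) and
`CoreData.nonempty_preBandData`. [cite: GompfStipsicz1999, §5.1] -/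
theorem Knot.exists_preBandData (K₁ K₂ : Knot) (avoid : Set (𝕊 3))
    (hdisj : Disjoint (range K₁) (range K₂)) (havoid : IsClosed avoid)
    (h₁ : Disjoint (range K₁) avoid) (h₂ : Disjoint (range K₂) avoid)
    (hpath : JoinedIn avoidᶜ (K₁ (circlePoint 0)) (K₂ (circlePoint 0))) :
    Nonempty (PreBandData K₁ K₂ avoid) := by
  obtain ⟨ν₁, ν₂, r, h, e, hr, hh, hh16, hT1, hT2, hT12, hg1, hg2, hea, he1, he2⟩ :=
    exists_coreLoop K₁ K₂ avoid hdisj havoid h₁ h₂ hpath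
  obtain ⟨νe⟩ := Knot.nonempty_tubularNbhd_holds e
  exact CoreData.nonempty_preBandData
    { ν₁ := ν₁, ν₂ := ν₂, r := r, h := h, e := e, νe := νe, r_pos := hr, h_pos := hh, h_le := hh16,
      tube₁ := hT1, tube₂ := hT2, tube₁₂ := hT12, germ₁ := hg1, germ₂ := hg2, e_not_mem := hea,
      e_mem_left := he1, e_mem_right := he2, isClosed_avoid := havoid }

end Literature.Topology.FourManifolds
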